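import Mathlib
import Literature.Computability.AlgebraicComplexity.GroupTheoreticMatMul
import Literature.Barriers.MatrixMultiplication.TricoloredSumFreeBarrier
import HarnessLib

/-!
# Barrier: STPP families of punctured-subspace frames in `F_q^m` have a power-saving packing defect — no dimension-exact frame design in bounded rank (proved)

Topic `Literature/Barriers/MatrixMultiplication` (D-0021 barrier catalogue for the summit
`MatrixMultiplication`, `ω(ℂ) = 2`; group-theoretic approach of Cohn–Umans /
Cohn–Kleinberg–Szegedy–Umans in ABELIAN hosts `F_q^m` of BOUNDED RANK `m` and growing `q` — the
regime left open by the bounded-EXPONENT slice-rank barrier `TricoloredSumFreeBarrier` (Thm B of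
Blasiak–Church–Cohn–Grochow–Naslund–Sawin–Umans 2017 needs `exponent H ≤ ℓ`)).

Source: this project (route `MatrixMultiplication/AlgebraicSTPPDichotomy`, items FrameBarrier /
AlgebraicFrameBarrier / LineFrameBarrier / target ExactFrameDesign, 2026-08-15). Paper sketch:
planner evidence `REFUTATION.md` on item stmt-MatrixMultiplication-7622 (richness lemma +
projective second moment); this file is an independent formalisation in VECTOR form (no projective
geometry) by the standing-adversary seat of stmt-MatrixMultiplication-7621. Everything here is
PROVED (no named facts except the catalogue entry, which is discharged in this file).

## Catalogue entry

`BoundedRankFrameBarrier` (the D-0021 block is in its docstring, at the end of the file), PROVED: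
`boundedRankFrameBarrier_holds`. Its statement is LITERALLY the body of the route decl
`Summit.MatrixMultiplication.MatrixMultiplication.Theses.AlgebraicSTPPDichotomy.FrameBarrier`, so a
prover closes that item by `exact Literature.Barriers.MatrixMultiplication.boundedRankFrameBarrier_holds`.

## Content (namespace `STPPFrame`)

* Colour classes `diffSet X Y i = X_i − Y_i`; `stpp_colour_sum` (the `IsSTPP` clause in colour
  form: `σ + τ + υ = 0`, `σ ∈ A_i − B_i`, `τ ∈ B_j − C_j`, `υ ∈ C_k − A_k` ⇒ `i = j = k`);
  `directSum_of_stpp` (TPP ⇒ `V_i ⊕ W_i ⊕ U_i` direct for blocks with non-empty sets, `|F| ≥ 3`).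
* **Richness lemma** `richness`: no 2-dimensional `P ≤ F^m` contains four pairwise
  non-proportional vectors from each of the three colour classes.
* Counting over `Ω` = ordered linearly independent pairs of `F^m`: `card_Omega_le`
  (`|Ω| ≤ (q^m−1)(q^m−q)`), `card_G_ge` (`≥ (q^m−q)(q²−1)` pairs span a given `v ≠ 0`),
  `card_G_inter_le` (`≤ (q²−1)(q²−q)` pairs span two independent vectors), first and second
  moments `sum_sCount`, `sum_sCount_sq_le`, and the Chebyshev step `four_mul_card_bad_le`
  (a set `X ∌ 0` with `(q+1)|X| ≥ 9(q^m−1)` is seen `≤ 3(q−1)` times by at most `|Ω|/4` pairs).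
* `four_nonprop`, `threeDense_false`, colour classes as Finsets (`colour`, `card_colour` = the
  packing injectivity `Σ|A_i||B_i| = |⋃(A_i − B_i)|`), `frame_packing_defect`:
  `(q+1) Σ_i |X_i||Y_i| < 9 (q^m − 1)` for one of the three pairings (`|F| ≥ 3`, `m ≥ 2`).
* Assembly `boundedRankFrameBarrier_holds` with `ε_m = 2/(6m+5)`, `q₀ = 81`, through BCCGNSU
  Lemma 2.4 in effective form (tree: `IsSTPP.sum_rpow_le_card_of_packing_defect`, `IsSTPP.rotate`);
  rank `m ≤ 1` has no block with three non-empty sets (`no_full_block`).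

## Design choices

* Frames are given as in the route file: Finsets `A i` tied to submodules `V i` by membership
  iffs `v ∈ A i ↔ v ∈ V i ∧ v ≠ 0`; `IsSTPP` is the tree's (CKSU 2005 Def. 5.1).
* All counting is over vectors and ordered pairs of vectors (`Finset`), never over subspaces, so
  no Gaussian binomials are needed; the price is the harmless factor `q − 1` between vectors and
  lines, absorbed in the threshold `3(q−1)`.
* Constants are not optimised (`9`, `81`, `2/(6m+5)`); the paper sketch has `7.86` and
  `ε_m ≈ 2/(3m)`.
-/

noncomputable section

open Finset
open Literature.Computability.AlgebraicComplexity

namespace Literature.Barriers.MatrixMultiplication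

namespace STPPFrame

/-! ## Colour classes, the STPP clause in colour form, and the richness lemma -/

section Richness

variable {F : Type} [Field F] {m N : ℕ}

/-- The colour class `X_i − Y_i` of block `i`, as a set of vectors. [folklore] -/
def diffSet (X Y : Fin N → Finset (Fin m → F)) (i : Fin N) : Set (Fin m → F) :=
  {σ | ∃ x ∈ X i, ∃ y ∈ Y i, σ = x - y}

variable {V W U : Fin N → Submodule F (Fin m → F)} {A B C : Fin N → Finset (Fin m → F)}

/-- The STPP clause in colour form: `σ + τ + υ = 0` with `σ ∈ A_i − B_i`, `τ ∈ B_j − C_j`,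
`υ ∈ C_k − A_k` forces `i = j = k`. [cite: BlasiakChurchCohnGrochowNaslundSawinUmans2017, §3.1] -/
theorem stpp_colour_sum (hS : IsSTPP A B C) {i j k : Fin N} {σ τ υ : Fin m → F}
    (hσ : σ ∈ diffSet A B i) (hτ : τ ∈ diffSet B C j) (hυ : υ ∈ diffSet C A k) (h : σ + τ + υ = 0) :
    i = j ∧ j = k := by
  obtain ⟨s', hs', t, ht, rfl⟩ := hσ
  obtain ⟨t', ht', u, hu, rfl⟩ := hτ
  obtain ⟨u', hu', s, hs, rfl⟩ := hυ
  have := hS i j k s hs s' hs' t ht t' ht' u hu u' hu' (by rw [← h]; abel)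
  exact ⟨this.1, this.2.1⟩

/-- Colour classes of punctured-subspace frames are closed under non-zero scalars. [folklore] -/
theorem inDiff_smul {X Y : Fin N → Finset (Fin m → F)} {VX VY : Fin N → Submodule F (Fin m → F)}
    (hX : ∀ i v, v ∈ X i ↔ v ∈ VX i ∧ v ≠ 0) (hY : ∀ i v, v ∈ Y i ↔ v ∈ VY i ∧ v ≠ 0)
    {i : Fin N} {σ : Fin m → F} (h : σ ∈ diffSet X Y i) {c : F} (hc : c ≠ 0) :
    (c • σ) ∈ diffSet X Y i := by
  obtain ⟨x, hx, y, hy, rfl⟩ := h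
  rw [hX] at hx; rw [hY] at hy
  refine ⟨c • x, (hX i _).2 ⟨(VX i).smul_mem c hx.1, smul_ne_zero hc hx.2⟩, c • y,
    (hY i _).2 ⟨(VY i).smul_mem c hy.1, smul_ne_zero hc hy.2⟩, by rw [smul_sub]⟩

/-- `σ ∈ X_i − Y_i` lies in `VX_i ⊔ VY_i`. [folklore] -/
theorem inDiff_mem_sup {X Y : Fin N → Finset (Fin m → F)} {VX VY : Fin N → Submodule F (Fin m → F)}
    (hX : ∀ i v, v ∈ X i ↔ v ∈ VX i ∧ v ≠ 0) (hY : ∀ i v, v ∈ Y i ↔ v ∈ VY i ∧ v ≠ 0)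
    {i : Fin N} {σ : Fin m → F} (h : σ ∈ diffSet X Y i) : σ ∈ VX i ⊔ VY i := by
  obtain ⟨x, hx, y, hy, rfl⟩ := h
  exact Submodule.sub_mem _ (Submodule.mem_sup_left ((hX i x).1 hx).1)
    (Submodule.mem_sup_right ((hY i y).1 hy).1)

/-- Two non-proportional vectors are linearly independent. [folklore] -/
theorem linearIndependent_pair_of_not_prop {x y : Fin m → F} (hxy : ∀ c : F, x ≠ c • y)
    (hyx : ∀ c : F, y ≠ c • x) : LinearIndependent F ![x, y] := by
  rw [LinearIndependent.pair_iff]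
  intro s t hst
  by_cases hs : s = 0
  · subst hs
    simp only [zero_smul, zero_add] at hst
    by_cases ht : t = 0
    · exact ⟨rfl, ht⟩
    · exact absurd (by rw [zero_smul]; exact (smul_eq_zero.1 hst).resolve_left ht) (hyx 0)
  · exfalso
    refine hxy (-(s⁻¹ * t)) ?_
    have : x = s⁻¹ • (s • x) := by rw [smul_smul, inv_mul_cancel₀ hs, one_smul]
    rw [this, show s • x = -(t • y) from eq_neg_of_add_eq_zero_left hst, smul_neg, smul_smul,
      neg_smul]

/-- In a 2-dimensional `P`, two non-proportional members span `P`. [folklore] -/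
theorem span_pair_eq_of_finrank_two {P : Submodule F (Fin m → F)} (hP : Module.finrank F P = 2)
    {x y : Fin m → F} (hx : x ∈ P) (hy : y ∈ P) (hxy : ∀ c : F, x ≠ c • y)
    (hyx : ∀ c : F, y ≠ c • x) : Submodule.span F (Set.range ![x, y]) = P := by
  have hli := linearIndependent_pair_of_not_prop hxy hyx
  refine Submodule.eq_of_le_of_finrank_eq ?_ ?_
  · rw [Submodule.span_le]
    rintro _ ⟨a, rfl⟩
    fin_cases a <;> simpa
  · rw [finrank_span_eq_card hli, hP]
    simp

/-- **Transversal step**: three pairwise non-proportional vectors of a 2-dimensional `P` lying in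
`S_i`, `T_j`, `U_k` force `i = j = k` (write `υ = λσ + μτ` with `λ, μ ≠ 0` and rescale).
[folklore] -/
theorem labels_eq_of_plane (hS : IsSTPP A B C)
    (hA : ∀ i v, v ∈ A i ↔ v ∈ V i ∧ v ≠ 0) (hB : ∀ i v, v ∈ B i ↔ v ∈ W i ∧ v ≠ 0)
    (hC : ∀ i v, v ∈ C i ↔ v ∈ U i ∧ v ≠ 0)
    {P : Submodule F (Fin m → F)} (hP : Module.finrank F P = 2) {i j k : Fin N}
    {σ τ υ : Fin m → F} (hσP : σ ∈ P) (hτP : τ ∈ P) (hυP : υ ∈ P)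
    (hσ : σ ∈ diffSet A B i) (hτ : τ ∈ diffSet B C j) (hυ : υ ∈ diffSet C A k)
    (nστ : ∀ c : F, σ ≠ c • τ) (nτσ : ∀ c : F, τ ≠ c • σ) (nυσ : ∀ c : F, υ ≠ c • σ)
    (nυτ : ∀ c : F, υ ≠ c • τ) : i = j ∧ j = k := by
  have hspan := span_pair_eq_of_finrank_two hP hσP hτP nστ nτσ
  have hυ' : υ ∈ Submodule.span F (Set.range ![σ, τ]) := by rw [hspan]; exact hυP
  obtain ⟨c, hc⟩ := (Submodule.mem_span_range_iff_exists_fun F).1 hυ'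
  simp only [Fin.sum_univ_two, Matrix.cons_val_zero, Matrix.cons_val_one] at hc
  have hc0 : c 0 ≠ 0 := fun h0 => nυτ (c 1) (by rw [← hc, h0, zero_smul, zero_add])
  have hc1 : c 1 ≠ 0 := fun h1 => nυσ (c 0) (by rw [← hc, h1, zero_smul, add_zero])
  refine stpp_colour_sum hS (inDiff_smul hA hB hσ (neg_ne_zero.2 hc0))
    (inDiff_smul hB hC hτ (neg_ne_zero.2 hc1)) hυ ?_
  rw [← hc, neg_smul, neg_smul]; abel

/-- Among four pairwise non-proportional vectors, one is proportional to neither of two given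
non-zero vectors (each given vector is proportional to at most one of the four). [folklore] -/
theorem exists_avoid_two {w : Fin 4 → (Fin m → F)} (nw : ∀ a b, a ≠ b → ∀ c : F, w a ≠ c • w b)
    {x y : Fin m → F} (hx : x ≠ 0) (hy : y ≠ 0) :
    ∃ a, (∀ c : F, w a ≠ c • x) ∧ (∀ c : F, w a ≠ c • y) := by
  classical
  -- two of the four proportional to the same non-zero vector would be proportional to each other
  have key : ∀ {z : Fin m → F}, z ≠ 0 → ∀ {a b}, a ≠ b → ∀ {c d : F}, w a = c • z → w b = d • z →
      False := by
    intro z hz a b hab c d ha hb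
    have hd : d ≠ 0 := by
      rintro rfl
      exact nw b a (Ne.symm hab) 0 (by rw [hb, zero_smul, zero_smul])
    refine nw a b hab (c * d⁻¹) ?_
    rw [ha, hb, smul_smul, mul_assoc, inv_mul_cancel₀ hd, mul_one]
  by_contra hcon
  push Not at hcon
  -- every index is x-bad or y-bad; pigeonhole on the x-bad predicate
  let g : Fin 4 → Bool := fun a => decide (∃ c : F, w a = c • x)
  obtain ⟨a, -, b, -, hab, hgab⟩ : ∃ a ∈ (univ : Finset (Fin 4)), ∃ b ∈ (univ : Finset (Fin 4)),
      a ≠ b ∧ g a = g b :=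
    Finset.exists_ne_map_eq_of_card_lt_of_maps_to (t := (univ : Finset Bool)) (by simp)
      (fun a _ => mem_univ (g a))
  by_cases hga : g a = true
  · have hgb : g b = true := hgab ▸ hga
    simp only [g, decide_eq_true_eq] at hga hgb
    obtain ⟨c, hc⟩ := hga; obtain ⟨d, hd⟩ := hgb
    exact key hx hab hc hd
  · have hgb : ¬ g b = true := fun h => hga (hgab ▸ h)
    simp only [g, decide_eq_true_eq, not_exists] at hga hgb
    obtain ⟨c, hc⟩ := (hcon a) hga
    obtain ⟨d, hd⟩ := (hcon b) hgb
    exact key hy hab hc hd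

/-- A field with at least three elements has an element `∉ {0, −1}`. [folklore] -/
theorem exists_ne_zero_ne_neg_one [Fintype F] (hF : 3 ≤ Fintype.card F) :
    ∃ c : F, c ≠ 0 ∧ c ≠ -1 := by
  classical
  by_contra h
  push Not at h
  have hsub : (univ : Finset F) ⊆ {0, -1} := fun c _ => by
    by_cases hc : c = 0
    · simp [hc]
    · simp [h c hc]
  have := (Finset.card_le_card hsub).trans (Finset.card_le_two)
  rw [Finset.card_univ] at this
  omega

/-- Every vector of `V` is a difference of two elements of the punctured `V` (`|F| ≥ 3`, `V ≠ 0`).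
[folklore] -/
theorem exists_sub_eq_of_punctured [Fintype F] (hF : 3 ≤ Fintype.card F)
    {VX : Submodule F (Fin m → F)} {X : Finset (Fin m → F)} (hX : ∀ v, v ∈ X ↔ v ∈ VX ∧ v ≠ 0)
    (hne : X.Nonempty) {v : Fin m → F} (hv : v ∈ VX) : ∃ s ∈ X, ∃ s' ∈ X, s' - s = v := by
  by_cases hv0 : v = 0
  · obtain ⟨s, hs⟩ := hne
    exact ⟨s, hs, s, hs, by rw [hv0, sub_self]⟩
  · obtain ⟨c, hc0, hc1⟩ := exists_ne_zero_ne_neg_one hF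
    refine ⟨c • v, (hX _).2 ⟨VX.smul_mem c hv, smul_ne_zero hc0 hv0⟩, (c + 1) • v,
      (hX _).2 ⟨VX.smul_mem _ hv, smul_ne_zero (fun h => hc1 ?_) hv0⟩, by rw [add_smul]; simp⟩
    linear_combination h

/-- **TPP forces a direct sum**: in an STPP frame family over a field with `|F| ≥ 3`, a block
whose three sets are non-empty has independent `V_i, W_i, U_i`. [folklore] -/
theorem directSum_of_stpp [Fintype F] (hF : 3 ≤ Fintype.card F) (hS : IsSTPP A B C)
    (hA : ∀ i v, v ∈ A i ↔ v ∈ V i ∧ v ≠ 0) (hB : ∀ i v, v ∈ B i ↔ v ∈ W i ∧ v ≠ 0)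
    (hC : ∀ i v, v ∈ C i ↔ v ∈ U i ∧ v ≠ 0) {i : Fin N}
    (hAi : (A i).Nonempty) (hBi : (B i).Nonempty) (hCi : (C i).Nonempty)
    {v w u : Fin m → F} (hv : v ∈ V i) (hw : w ∈ W i) (hu : u ∈ U i) (h : v + w + u = 0) :
    v = 0 ∧ w = 0 ∧ u = 0 := by
  obtain ⟨s, hs, s', hs', rfl⟩ := exists_sub_eq_of_punctured hF (hA i) hAi hv
  obtain ⟨t, ht, t', ht', rfl⟩ := exists_sub_eq_of_punctured hF (hB i) hBi hw
  obtain ⟨u₀, hu₀, u', hu', rfl⟩ := exists_sub_eq_of_punctured hF (hC i) hCi hu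
  obtain ⟨-, -, h1, h2, h3⟩ := hS i i i s hs s' hs' t ht t' ht' u₀ hu₀ u' hu' h
  exact ⟨by rw [h1, sub_self], by rw [h2, sub_self], by rw [h3, sub_self]⟩

/-- **RICHNESS LEMMA.** In an STPP family of punctured-subspace frames over a finite field with
`|F| ≥ 3`, no 2-dimensional subspace `P ≤ F^m` contains four pairwise non-proportional vectors
(= four distinct lines through 0) from each of the three colour classes
`S = ⋃ᵢ (A_i − B_i)`, `T = ⋃ⱼ (B_j − C_j)`, `U = ⋃ₖ (C_k − A_k)`.
Proof: transversals force all twelve labels to be one block `i` (`labels_eq_of_plane` +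
`exists_avoid_two`); then `P = span(σ₀,σ₁) ≤ V_i ⊔ W_i` and `P = span(τ₀,τ₁) ≤ W_i ⊔ U_i`, so
`σ₀ = s' − t ∈ W_i ⊔ U_i`, i.e. `s' + (−t − w) + (−u) = 0`, and the direct sum
(`directSum_of_stpp`) gives `s' = 0`, contradicting `s' ∈ A_i`. This is the key lemma of the
second-moment proof of FrameBarrier (planner-cruxidea-9732-2, REFUTATION.md on stmt-7622):
with it, Chebyshev over the 2-subspaces of `F^m` (mean `μ = n(q²−1)/(q^m−1)`, `Var ≤ μ`) bounds
`min over the three pairings of Σ_i |A_i||B_i|` by `7.86 (q^m − 1)/(q + 1)`, a packing defect of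
a factor `≈ q/8`, whence FrameBarrier by `IsSTPP.sum_rpow_le_card_of_packing_defect`, and this
crux by `algebraicFrameBarrier_of_frameBarrier`. [folklore] -/
theorem richness [Fintype F] (hF : 3 ≤ Fintype.card F) (hS : IsSTPP A B C)
    (hA : ∀ i v, v ∈ A i ↔ v ∈ V i ∧ v ≠ 0) (hB : ∀ i v, v ∈ B i ↔ v ∈ W i ∧ v ≠ 0)
    (hC : ∀ i v, v ∈ C i ↔ v ∈ U i ∧ v ≠ 0)
    {P : Submodule F (Fin m → F)} (hP : Module.finrank F P = 2)
    (σ τ υ : Fin 4 → (Fin m → F)) (iS iT iU : Fin 4 → Fin N)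
    (hσ : ∀ a, (σ a) ∈ diffSet A B (iS a)) (hτ : ∀ a, (τ a) ∈ diffSet B C (iT a))
    (hυ : ∀ a, (υ a) ∈ diffSet C A (iU a))
    (hσP : ∀ a, σ a ∈ P) (hτP : ∀ a, τ a ∈ P) (hυP : ∀ a, υ a ∈ P)
    (nσ : ∀ a b, a ≠ b → ∀ c : F, σ a ≠ c • σ b) (nτ : ∀ a b, a ≠ b → ∀ c : F, τ a ≠ c • τ b)
    (nυ : ∀ a b, a ≠ b → ∀ c : F, υ a ≠ c • υ b) : False := by
  -- non-vanishing
  have σ0 : ∀ a, σ a ≠ 0 := fun a h => by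
    obtain ⟨b, hb⟩ : ∃ b : Fin 4, a ≠ b := ⟨a + 1, by simp⟩
    exact nσ a b hb 0 (by rw [h, zero_smul])
  have τ0 : ∀ a, τ a ≠ 0 := fun a h => by
    obtain ⟨b, hb⟩ : ∃ b : Fin 4, a ≠ b := ⟨a + 1, by simp⟩
    exact nτ a b hb 0 (by rw [h, zero_smul])
  -- symmetry of non-proportionality between non-zero vectors
  have nsymm : ∀ {x y : Fin m → F}, x ≠ 0 → y ≠ 0 → (∀ c : F, x ≠ c • y) →
      ∀ c : F, y ≠ c • x := by
    intro x y _ hy hxy c hyc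
    have hc : c ≠ 0 := by rintro rfl; rw [zero_smul] at hyc; exact hy hyc
    exact hxy c⁻¹ (by rw [hyc, smul_smul, inv_mul_cancel₀ hc, one_smul])
  -- B1: a non-proportional (σ a, τ b) pair has equal labels
  have B1 : ∀ a b, (∀ c : F, τ b ≠ c • σ a) → iS a = iT b := by
    intro a b hba
    obtain ⟨d, hd1, hd2⟩ := exists_avoid_two nυ (σ0 a) (τ0 b)
    exact (labels_eq_of_plane hS hA hB hC hP (hσP a) (hτP b) (hυP d) (hσ a) (hτ b) (hυ d)
      (nsymm (τ0 b) (σ0 a) hba) hba hd1 hd2).1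
  -- B2: all σ-labels agree
  have B2 : ∀ a, iS a = iS 0 := by
    intro a
    obtain ⟨b, hb1, hb2⟩ := exists_avoid_two nτ (σ0 a) (σ0 0)
    rw [B1 a b hb1, B1 0 b hb2]
  -- B3: all τ-labels agree with the σ-label
  have B3 : ∀ b, iT b = iS 0 := by
    intro b
    obtain ⟨a, ha1, -⟩ := exists_avoid_two nσ (τ0 b) (τ0 b)
    rw [← B1 a b (nsymm (σ0 a) (τ0 b) ha1), B2 a]
  set i := iS 0 with hi
  -- geometry: P ≤ V i ⊔ W i and P ≤ W i ⊔ U i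
  have hPVW : P ≤ V i ⊔ W i := by
    rw [← span_pair_eq_of_finrank_two hP (hσP 0) (hσP 1) (nσ 0 1 (by decide)) (nσ 1 0 (by decide)),
      Submodule.span_le]
    rintro _ ⟨a, rfl⟩
    fin_cases a
    · simpa using inDiff_mem_sup hA hB (hσ 0)
    · simpa [← B2 1] using inDiff_mem_sup hA hB (hσ 1)
  have hPWU : P ≤ W i ⊔ U i := by
    rw [← span_pair_eq_of_finrank_two hP (hτP 0) (hτP 1) (nτ 0 1 (by decide)) (nτ 1 0 (by decide)),
      Submodule.span_le]
    rintro _ ⟨a, rfl⟩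
    fin_cases a
    · simpa [← B3 0] using inDiff_mem_sup hB hC (hτ 0)
    · simpa [← B3 1] using inDiff_mem_sup hB hC (hτ 1)
  -- σ 0 = s' - t with s' ∈ A i, t ∈ B i; and σ 0 ∈ W i ⊔ U i
  obtain ⟨s', hs', t, ht, hσ0⟩ := hσ 0
  obtain ⟨w, hw, u, hu, hwu⟩ := Submodule.mem_sup.1 (hPWU (hσP 0))
  have hs'V : s' ∈ V i ∧ s' ≠ 0 := (hA i s').1 hs'
  have htW : t ∈ W i := ((hB i t).1 ht).1
  -- nonemptiness of the three sets of block i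
  have hAi : (A i).Nonempty := ⟨s', hs'⟩
  have hBi : (B i).Nonempty := ⟨t, ht⟩
  have hCi : (C i).Nonempty := by
    obtain ⟨t', -, u', hu', -⟩ := hτ 0
    rw [B3 0] at hu'
    exact ⟨u', hu'⟩
  have hrel : s' + (-(t + w)) + (-u) = 0 := by
    have : s' - t = w + u := by rw [← hσ0, hwu]
    rw [← sub_eq_zero] at this
    rw [← this]; abel
  have := (directSum_of_stpp hF hS hA hB hC hAi hBi hCi hs'V.1
    ((W i).neg_mem ((W i).add_mem htW hw)) ((U i).neg_mem hu) hrel).1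
  exact hs'V.2 this

end Richness

/-! ## The count over independent ordered pairs -/

section Count

open scoped Classical

variable {F : Type} [Field F] [Fintype F] {m : ℕ}

local notation "E" => (Fin m → F)
local notation "q" => Fintype.card F


/-- The line through `v` (with `0`): the members of `F ∙ v`. [folklore] -/
def lineOf (v : E) : Finset E := univ.filter fun w => w ∈ Submodule.span F ({v} : Set E)

/-- The plane spanned by `y, z` (as a Finset): the members of `span {y, z}`. [folklore] -/
def planeOf (y z : E) : Finset E := univ.filter fun w => w ∈ Submodule.span F ({y, z} : Set E)

omit [Fintype F] in
/-- Membership in the span of a pair, solved for the member. [folklore] -/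
theorem mem_span_pair' {y z w : E} :
    w ∈ Submodule.span F ({y, z} : Set E) ↔ ∃ a b : F, w = a • y + b • z := by
  rw [Submodule.mem_span_pair]
  exact ⟨fun ⟨a, b, h⟩ => ⟨a, b, h.symm⟩, fun ⟨a, b, h⟩ => ⟨a, b, h.symm⟩⟩

omit [Fintype F] in
/-- `LinearIndependent F ![y, z]`, applied. [folklore] -/
theorem pair_apply {y z : E} (h : LinearIndependent F ![y, z]) {a b : F}
    (hab : a • y + b • z = 0) : a = 0 ∧ b = 0 :=
  LinearIndependent.pair_iff.1 h a b hab

omit [Fintype F] in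
/-- The first vector of an independent pair is non-zero. [folklore] -/
theorem ne_zero_left {y z : E} (h : LinearIndependent F ![y, z]) : y ≠ 0 := fun hy =>
  one_ne_zero (pair_apply h (a := 1) (b := 0) (by rw [hy, smul_zero, zero_smul, add_zero])).1

omit [Fintype F] in
/-- The second vector of an independent pair is non-zero. [folklore] -/
theorem ne_zero_right {y z : E} (h : LinearIndependent F ![y, z]) : z ≠ 0 := fun hz =>
  one_ne_zero (pair_apply h (a := 0) (b := 1) (by rw [hz, smul_zero, zero_smul, add_zero])).2

omit [Fintype F] in
/-- A pair is independent iff the first vector is non-zero and the second is off its line.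
[folklore] -/
theorem indep_iff_not_mem_line {y z : E} (hy : y ≠ 0) :
    LinearIndependent F ![y, z] ↔ ¬ ∃ c : F, z = c • y := by
  rw [LinearIndependent.pair_iff' hy]
  simp only [ne_eq, not_exists]
  exact forall_congr' fun a => by rw [eq_comm]

/-- Membership in `lineOf`. [folklore] -/
theorem mem_lineOf {v w : E} : w ∈ lineOf v ↔ ∃ c : F, w = c • v := by
  simp only [lineOf, mem_filter, mem_univ, true_and, Submodule.mem_span_singleton]
  exact ⟨fun ⟨c, h⟩ => ⟨c, h.symm⟩, fun ⟨c, h⟩ => ⟨c, h.symm⟩⟩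

/-- Membership in `planeOf`. [folklore] -/
theorem mem_planeOf {y z w : E} : w ∈ planeOf y z ↔ ∃ a b : F, w = a • y + b • z := by
  simp only [planeOf, mem_filter, mem_univ, true_and]
  exact mem_span_pair'

/-- Helper `zero_mem_lineOf` of the bounded-rank frame count. [folklore] -/
theorem zero_mem_lineOf (v : E) : (0 : E) ∈ lineOf v := mem_lineOf.2 ⟨0, by rw [zero_smul]⟩

/-- Helper `self_mem_lineOf` of the bounded-rank frame count. [folklore] -/
theorem self_mem_lineOf (v : E) : v ∈ lineOf v := mem_lineOf.2 ⟨1, by rw [one_smul]⟩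

/-- A line through a non-zero vector has `q` elements. [folklore] -/
theorem card_lineOf {v : E} (hv : v ≠ 0) : (lineOf v).card = q := by
  have : lineOf v = (univ : Finset F).image fun c => c • v := by
    ext w; simp [mem_lineOf, eq_comm]
  rw [this, card_image_of_injective _ (smul_left_injective F hv), card_univ]

/-- The plane of an independent pair has `q²` elements. [folklore] -/
theorem card_planeOf {y z : E} (h : LinearIndependent F ![y, z]) :
    (planeOf y z).card = q ^ 2 := by
  have : planeOf y z = ((univ : Finset F) ×ˢ (univ : Finset F)).image
      fun p => p.1 • y + p.2 • z := by
    ext w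
    simp only [mem_planeOf, mem_image, mem_product, mem_univ, true_and, Prod.exists]
    constructor
    · rintro ⟨a, b, rfl⟩; exact ⟨a, b, rfl⟩
    · rintro ⟨a, b, rfl⟩; exact ⟨a, b, rfl⟩
  rw [this, card_image_of_injOn, card_product, card_univ, sq]
  rintro ⟨a, b⟩ - ⟨a', b'⟩ - hab
  simp only at hab
  have h0 : (a - a') • y + (b - b') • z = 0 := by
    calc (a - a') • y + (b - b') • z = (a • y + b • z) - (a' • y + b' • z) := by module
      _ = 0 := by rw [hab, sub_self]
  obtain ⟨h1, h2⟩ := pair_apply h h0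
  rw [sub_eq_zero] at h1 h2
  rw [h1, h2]

/-- Helper `lineOf_subset_planeOf` of the bounded-rank frame count. [folklore] -/
theorem lineOf_subset_planeOf {y z w : E} (hw : w ∈ planeOf y z) : lineOf w ⊆ planeOf y z := by
  intro x hx
  obtain ⟨c, rfl⟩ := mem_lineOf.1 hx
  obtain ⟨a, b, rfl⟩ := mem_planeOf.1 hw
  exact mem_planeOf.2 ⟨c * a, c * b, by module⟩

/-- The set `Ω` of independent ordered pairs. [folklore] -/
def Omega (F : Type) [Field F] [Fintype F] (m : ℕ) : Finset ((Fin m → F) × (Fin m → F)) :=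
  univ.filter fun ω => LinearIndependent F ![ω.1, ω.2]

/-- Membership in `Ω`. [folklore] -/
theorem mk_mem_Omega {y z : E} : (y, z) ∈ Omega F m ↔ LinearIndependent F ![y, z] := by
  simp [Omega]

/-- `|Ω| ≤ (q^m − 1)(q^m − q)`. [folklore] -/
theorem card_Omega_le : (Omega F m).card ≤ (q ^ m - 1) * (q ^ m - q) := by
  -- inject Ω into the sigma-set {y ≠ 0} × (univ \ line y)
  let S : Finset (Σ _ : E, E) := (univ.filter fun y : E => y ≠ 0).sigma fun y => univ \ lineOf y
  have hS : S.card = (q ^ m - 1) * (q ^ m - q) := by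
    rw [card_sigma]
    have : ∀ y ∈ (univ.filter fun y : E => y ≠ 0), (univ \ lineOf y).card = q ^ m - q := by
      intro y hy
      rw [card_sdiff_of_subset (subset_univ _), card_univ, Fintype.card_fun, Fintype.card_fin,
        card_lineOf (mem_filter.1 hy).2]
    rw [sum_congr rfl this, sum_const, smul_eq_mul]
    congr 1
    rw [filter_ne' univ (0 : E), card_erase_of_mem (mem_univ _), card_univ, Fintype.card_fun,
      Fintype.card_fin]
  rw [← hS]
  refine card_le_card_of_injOn (fun ω => ⟨ω.1, ω.2⟩) ?_ ?_
  · rintro ⟨y, z⟩ hω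
    have h := mk_mem_Omega.1 hω
    simp only [S, coe_sigma, Set.mem_sigma_iff, mem_coe, mem_filter, mem_univ, true_and, mem_sdiff]
    exact ⟨ne_zero_left h, (indep_iff_not_mem_line (ne_zero_left h)).1 h ∘ mem_lineOf.1⟩
  · rintro ⟨y, z⟩ - ⟨y', z'⟩ - h
    simp only [Sigma.mk.injEq] at h
    obtain ⟨rfl, h2⟩ := h
    simp only [heq_eq_eq] at h2
    rw [h2]

/-- The good set of a vector: independent pairs whose span contains it. [folklore] -/
def G (v : E) : Finset (E × E) :=
  (Omega F m).filter fun ω => v ∈ Submodule.span F ({ω.1, ω.2} : Set E)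

/-- Membership in `G v`. [folklore] -/
theorem mk_mem_G {v y z : E} :
    (y, z) ∈ G v ↔ LinearIndependent F ![y, z] ∧ ∃ a b : F, v = a • y + b • z := by
  simp only [G, mem_filter, mk_mem_Omega, mem_span_pair']

/-- `|G(v)| ≥ (q^m − q)(q² − 1)` for `v ≠ 0`. [folklore] -/
theorem card_G_ge {v : E} (hv : v ≠ 0) : (q ^ m - q) * (q ^ 2 - 1) ≤ (G v).card := by
  -- family (a): y ∈ line v \ {0}, z ∉ line v
  let Da : Finset (E × E) := ((lineOf v).erase 0) ×ˢ (univ \ lineOf v)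
  -- family (b): y ∉ line v, z = a • v + b • y with a ≠ 0
  let Db : Finset (E × (F × F)) :=
    (univ \ lineOf v) ×ˢ ((univ.filter fun a : F => a ≠ 0) ×ˢ univ)
  let fb : E × (F × F) → E × E := fun p => (p.1, p.2.1 • v + p.2.2 • p.1)
  have hDa : Da.card = (q - 1) * (q ^ m - q) := by
    rw [card_product, card_erase_of_mem (zero_mem_lineOf v), card_lineOf hv,
      card_sdiff_of_subset (subset_univ _), card_univ, Fintype.card_fun, Fintype.card_fin,
      card_lineOf hv]
  have hDb : Db.card = (q ^ m - q) * ((q - 1) * q) := by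
    rw [card_product, card_sdiff_of_subset (subset_univ _), card_univ, Fintype.card_fun,
      Fintype.card_fin, card_lineOf hv, card_product, filter_ne' univ (0 : F),
      card_erase_of_mem (mem_univ _), card_univ]
  -- y ∉ line v ⇒ Indep v y
  have key : ∀ {y : E}, y ∉ lineOf v → LinearIndependent F ![v, y] := fun hy =>
    (indep_iff_not_mem_line hv).2 (fun h => hy (mem_lineOf.2 h))
  have hfb_inj : Set.InjOn fb Db := by
    rintro ⟨y, a, b⟩ hy ⟨y', a', b'⟩ - h
    simp only [fb, Prod.mk.injEq] at h
    obtain ⟨rfl, h⟩ := h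
    have hy' : y ∉ lineOf v := (mem_sdiff.1 (mem_product.1 hy).1).2
    have h0 : (a - a') • v + (b - b') • y = 0 := by
      calc (a - a') • v + (b - b') • y = (a • v + b • y) - (a' • v + b' • y) := by module
        _ = 0 := by rw [h, sub_self]
    obtain ⟨h1, h2⟩ := pair_apply (key hy') h0
    rw [sub_eq_zero] at h1 h2
    rw [h1, h2]
  have hsubA : Da ⊆ G v := by
    rintro ⟨y, z⟩ hyz
    rw [mem_product, mem_erase, mem_sdiff] at hyz
    obtain ⟨⟨hy0, hy⟩, -, hz⟩ := hyz
    obtain ⟨c, rfl⟩ := mem_lineOf.1 hy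
    have hc : c ≠ 0 := by rintro rfl; exact hy0 (zero_smul _ _)
    refine mk_mem_G.2 ⟨(indep_iff_not_mem_line hy0).2 ?_, c⁻¹, 0, ?_⟩
    · rintro ⟨d, hd⟩
      exact hz (mem_lineOf.2 ⟨d * c, by rw [hd, smul_smul]⟩)
    · rw [smul_smul, inv_mul_cancel₀ hc]; module
  have hsubB : Db.image fb ⊆ G v := by
    intro ω hω
    obtain ⟨⟨y, a, b⟩, hp, rfl⟩ := mem_image.1 hω
    simp only [Db, mem_product, mem_sdiff, mem_univ, true_and, mem_filter] at hp
    obtain ⟨hy, ha, -⟩ := hp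
    have hy0 : y ≠ 0 := fun h => hy (h ▸ zero_mem_lineOf v)
    refine mk_mem_G.2 ⟨(indep_iff_not_mem_line hy0).2 ?_, -(a⁻¹ * b), a⁻¹, ?_⟩
    · rintro ⟨d, hd⟩
      -- a • v = (d - b) • y, so v ∈ line y, so y ∈ line v
      have hav : a • v = (d - b) • y := by
        calc a • v = (a • v + b • y) - b • y := by module
          _ = d • y - b • y := by rw [hd]
          _ = (d - b) • y := by module
      have hdb : d - b ≠ 0 := by
        intro h0; rw [h0, zero_smul] at hav; exact hv ((smul_eq_zero.1 hav).resolve_left ha)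
      apply hy
      refine mem_lineOf.2 ⟨(d - b)⁻¹ * a, ?_⟩
      rw [← smul_smul, hav, smul_smul, inv_mul_cancel₀ hdb, one_smul]
    · show v = -(a⁻¹ * b) • y + a⁻¹ • (a • v + b • y)
      rw [smul_add, smul_smul, smul_smul, inv_mul_cancel₀ ha]; module
  have hdisj : Disjoint Da (Db.image fb) := by
    rw [Finset.disjoint_left]
    rintro ⟨y, z⟩ hA hB
    rw [mem_product, mem_erase] at hA
    obtain ⟨⟨y', a, b⟩, hp, h⟩ := mem_image.1 hB
    simp only [fb, Prod.mk.injEq] at h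
    simp only [Db, mem_product, mem_sdiff, mem_univ, true_and] at hp
    exact hp.1 (h.1 ▸ hA.1.2)
  calc (q ^ m - q) * (q ^ 2 - 1) = Da.card + (Db.image fb).card := by
        rw [card_image_of_injOn hfb_inj, hDa, hDb]
        have hq : 1 ≤ q := Fintype.card_pos
        zify [hq, Nat.one_le_pow 2 q hq]
        ring
    _ = (Da ∪ Db.image fb).card := (card_union_of_disjoint hdisj).symm
    _ ≤ (G v).card := card_le_card (union_subset hsubA hsubB)

/-- If `v, v'` are independent and both lie in the span of a pair `(y, z)`, then `y, z` lie in the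
plane of `v, v'` (elementary 2×2 inversion). [folklore] -/
theorem mem_planeOf_of_inSpan {v v' y z : E} (hvv : LinearIndependent F ![v, v'])
    (hv : ∃ a b : F, v = a • y + b • z) (hv' : ∃ a b : F, v' = a • y + b • z) :
    y ∈ planeOf v v' ∧ z ∈ planeOf v v' := by
  obtain ⟨a, b, hvab⟩ := hv
  obtain ⟨c, d, hvcd⟩ := hv'
  -- the determinant is non-zero
  have hdet : a * d - b * c ≠ 0 := by
    intro hdet
    have h1 : d • v + (-b) • v' = 0 := by
      have : d • v + (-b) • v' = (a * d - b * c) • y := by rw [hvab, hvcd]; module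
      rw [this, hdet, zero_smul]
    obtain ⟨hd, hb⟩ := pair_apply hvv h1
    rw [neg_eq_zero] at hb
    subst hd; subst hb
    have h2 : c • v + (-a) • v' = 0 := by rw [hvab, hvcd]; module
    obtain ⟨hc, ha⟩ := pair_apply hvv h2
    rw [neg_eq_zero] at ha
    subst ha
    exact ne_zero_left hvv (by rw [hvab]; module)
  set D := a * d - b * c with hD
  refine ⟨mem_planeOf.2 ⟨D⁻¹ * d, -(D⁻¹ * b), ?_⟩, mem_planeOf.2 ⟨-(D⁻¹ * c), D⁻¹ * a, ?_⟩⟩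
  · have : (D⁻¹ * d) • v + -(D⁻¹ * b) • v' = (D⁻¹ * (a * d - b * c)) • y := by
      rw [hvab, hvcd]; module
    rw [this, ← hD, inv_mul_cancel₀ hdet, one_smul]
  · have : -(D⁻¹ * c) • v + (D⁻¹ * a) • v' = (D⁻¹ * (a * d - b * c)) • z := by
      rw [hvab, hvcd]; module
    rw [this, ← hD, inv_mul_cancel₀ hdet, one_smul]

/-- `|G(v) ∩ G(v')| ≤ (q² − 1)(q² − q)` for independent `v, v'`. [folklore] -/
theorem card_G_inter_le {v v' : E} (hvv : LinearIndependent F ![v, v']) :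
    ((Omega F m).filter fun ω : E × E => v ∈ Submodule.span F ({ω.1, ω.2} : Set E) ∧
      v' ∈ Submodule.span F ({ω.1, ω.2} : Set E)).card ≤ (q ^ 2 - 1) * (q ^ 2 - q) := by
  let P := planeOf v v'
  let S : Finset (Σ _ : E, E) := (P.erase 0).sigma fun y => P \ lineOf y
  have hS : S.card = (q ^ 2 - 1) * (q ^ 2 - q) := by
    rw [card_sigma]
    have : ∀ y ∈ P.erase 0, (P \ lineOf y).card = q ^ 2 - q := by
      intro y hy
      rw [card_sdiff_of_subset (lineOf_subset_planeOf (mem_erase.1 hy).2), card_planeOf hvv,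
        card_lineOf (mem_erase.1 hy).1]
    rw [sum_congr rfl this, sum_const, smul_eq_mul, card_erase_of_mem, card_planeOf hvv]
    exact mem_planeOf.2 ⟨0, 0, by simp⟩
  rw [← hS]
  refine card_le_card_of_injOn (fun ω => ⟨ω.1, ω.2⟩) ?_ ?_
  · rintro ⟨y, z⟩ hω
    obtain ⟨hΩ, h1, h2⟩ := mem_filter.1 hω
    have hind := mk_mem_Omega.1 hΩ
    obtain ⟨hy, hz⟩ := mem_planeOf_of_inSpan hvv (mem_span_pair'.1 h1) (mem_span_pair'.1 h2)
    simp only [S, P, coe_sigma, Set.mem_sigma_iff, mem_coe, mem_erase, mem_sdiff]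
    exact ⟨⟨ne_zero_left hind, hy⟩, hz,
      (indep_iff_not_mem_line (ne_zero_left hind)).1 hind ∘ mem_lineOf.1⟩
  · rintro ⟨y, z⟩ - ⟨y', z'⟩ - h
    simp only [Sigma.mk.injEq] at h
    obtain ⟨rfl, h2⟩ := h
    simp only [heq_eq_eq] at h2
    rw [h2]

/-! # (M2) Second moment: few independent pairs see few vectors of a dense set -/

/-- Number of vectors of `X` in the span of the pair `ω`. [folklore] -/
def sCount (X : Finset E) (ω : E × E) : ℕ :=
  (X.filter fun x => x ∈ Submodule.span F ({ω.1, ω.2} : Set E)).card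

/-- Pairs seeing at most `3(q−1)` vectors of `X` (i.e. at most three lines of a cone `X`). [folklore] -/
def Bad (X : Finset E) : Finset (E × E) := (Omega F m).filter fun ω => sCount X ω ≤ 3 * (q - 1)

/-- First moment: `Σ_ω s_X(ω) = Σ_{x∈X} |G(x)|`. [folklore] -/
theorem sum_sCount (X : Finset E) :
    ∑ ω ∈ Omega F m, sCount X ω = ∑ x ∈ X, (G x).card := by
  simp only [sCount, G, card_filter]
  exact Finset.sum_comm

/-- For `ω ∈ G(x)`: `s_X(ω) ≤ |X ∩ line x| + |{x' ∈ X \ line x : x' ∈ span ω}|`. Summed over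
`ω ∈ G(x)`: `Σ_{ω∈G x} s_X(ω) ≤ (q−1)|G x| + |X|·(q²−1)(q²−q)`. [folklore] -/
theorem sum_sCount_G_le (X : Finset E) (hX0 : (0 : E) ∉ X) {x : E} (hx : x ∈ X) :
    ∑ ω ∈ G x, sCount X ω ≤ (q - 1) * (G x).card + X.card * ((q ^ 2 - 1) * (q ^ 2 - q)) := by
  have hx0 : x ≠ 0 := fun h => hX0 (h ▸ hx)
  -- swap the sums
  have hswap : ∑ ω ∈ G x, sCount X ω =
      ∑ x' ∈ X, ((G x).filter fun ω : E × E =>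
        x' ∈ Submodule.span F ({ω.1, ω.2} : Set E)).card := by
    simp only [sCount, card_filter]
    exact Finset.sum_comm
  rw [hswap]
  -- split X into the part on the line of x and the rest
  have hsplit := (Finset.sum_filter_add_sum_filter_not X (fun x' => x' ∈ lineOf x)
    (fun x' => ((G x).filter fun ω : E × E =>
      x' ∈ Submodule.span F ({ω.1, ω.2} : Set E)).card)).symm
  rw [hsplit]
  refine add_le_add ?_ ?_
  · -- on the line: at most q - 1 points of X, each term ≤ |G x|
    calc ∑ x' ∈ X.filter (fun x' => x' ∈ lineOf x),
          ((G x).filter fun ω : E × E => x' ∈ Submodule.span F ({ω.1, ω.2} : Set E)).card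
        ≤ ∑ _x' ∈ X.filter (fun x' => x' ∈ lineOf x), (G x).card :=
          sum_le_sum fun _ _ => card_filter_le _ _
      _ = (X.filter (fun x' => x' ∈ lineOf x)).card * (G x).card := by
          rw [sum_const, smul_eq_mul]
      _ ≤ (q - 1) * (G x).card := by
          refine Nat.mul_le_mul_right _ ?_
          have hsub : X.filter (fun x' => x' ∈ lineOf x) ⊆ (lineOf x).erase 0 := by
            intro x' hx'
            rw [mem_filter] at hx'
            exact mem_erase.2 ⟨fun h => hX0 (h ▸ hx'.1), hx'.2⟩
          refine (card_le_card hsub).trans ?_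
          rw [card_erase_of_mem (zero_mem_lineOf x), card_lineOf hx0]
  · -- off the line: each term ≤ (q²-1)(q²-q)
    calc ∑ x' ∈ X.filter (fun x' => x' ∉ lineOf x),
          ((G x).filter fun ω : E × E => x' ∈ Submodule.span F ({ω.1, ω.2} : Set E)).card
        ≤ ∑ _x' ∈ X.filter (fun x' => x' ∉ lineOf x), (q ^ 2 - 1) * (q ^ 2 - q) := by
          refine sum_le_sum fun x' hx' => ?_
          have hind : LinearIndependent F ![x, x'] :=
            (indep_iff_not_mem_line hx0).2 (fun h => (mem_filter.1 hx').2 (mem_lineOf.2 h))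
          refine le_trans (le_of_eq ?_) (card_G_inter_le hind)
          simp only [G, filter_filter]
      _ = (X.filter (fun x' => x' ∉ lineOf x)).card * ((q ^ 2 - 1) * (q ^ 2 - q)) := by
          rw [sum_const, smul_eq_mul]
      _ ≤ X.card * ((q ^ 2 - 1) * (q ^ 2 - q)) :=
          Nat.mul_le_mul_right _ (card_filter_le _ _)

/-- Second moment: `Σ_ω s_X(ω)² ≤ (q−1) Σ_ω s_X(ω) + |X|²(q²−1)(q²−q)`. [folklore] -/
theorem sum_sCount_sq_le (X : Finset E) (hX0 : (0 : E) ∉ X) :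
    ∑ ω ∈ Omega F m, sCount X ω ^ 2 ≤
      (q - 1) * ∑ ω ∈ Omega F m, sCount X ω + X.card * (X.card * ((q ^ 2 - 1) * (q ^ 2 - q))) := by
  -- s² = Σ_{x ∈ X ∩ span ω} s
  have hsq : ∀ ω : E × E, sCount X ω ^ 2 =
      ∑ x ∈ X, if x ∈ Submodule.span F ({ω.1, ω.2} : Set E) then sCount X ω else 0 := by
    intro ω
    rw [sq, ← sum_filter, sum_const, smul_eq_mul, sCount]
  simp_rw [hsq]
  rw [Finset.sum_comm]
  -- inner sum over ω of the indicator = sum over G x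
  have hinner : ∀ x ∈ X, (∑ ω ∈ Omega F m,
      if x ∈ Submodule.span F ({ω.1, ω.2} : Set E) then sCount X ω else 0) =
      ∑ ω ∈ G x, sCount X ω := by
    intro x _
    rw [G, sum_filter]
  rw [sum_congr rfl hinner]
  calc ∑ x ∈ X, ∑ ω ∈ G x, sCount X ω
      ≤ ∑ x ∈ X, ((q - 1) * (G x).card + X.card * ((q ^ 2 - 1) * (q ^ 2 - q))) :=
        sum_le_sum fun x hx => sum_sCount_G_le X hX0 hx
    _ = (q - 1) * ∑ x ∈ X, (G x).card + X.card * (X.card * ((q ^ 2 - 1) * (q ^ 2 - q))) := by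
        rw [sum_add_distrib, mul_sum, sum_const, smul_eq_mul]
    _ = _ := by rw [sum_sCount]

/-- `Ω` is non-empty for `m ≥ 2`. [folklore] -/
theorem Omega_nonempty (hm : 2 ≤ m) : (Omega F m).Nonempty := by
  refine ⟨(Pi.single ⟨0, by omega⟩ 1, Pi.single ⟨1, by omega⟩ 1), mk_mem_Omega.2 ?_⟩
  rw [LinearIndependent.pair_iff]
  intro a b hab
  have h0 := congr_fun hab ⟨0, by omega⟩
  have h1 := congr_fun hab ⟨1, by omega⟩
  simp at h0 h1
  exact ⟨h0, h1⟩

/-- `Σ (f i − μ)² = Σ f i² − 2μ Σ f i + |s| μ²`. [folklore] -/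
theorem sum_sq_sub {ι : Type*} (s : Finset ι) (f : ι → ℝ) (μ : ℝ) :
    ∑ i ∈ s, (f i - μ) ^ 2 = ∑ i ∈ s, f i ^ 2 - 2 * μ * ∑ i ∈ s, f i + s.card * μ ^ 2 := by
  have : ∀ i, (f i - μ) ^ 2 = f i ^ 2 - 2 * μ * f i + μ ^ 2 := fun i => by ring
  simp_rw [this, sum_add_distrib, sum_sub_distrib, ← mul_sum, sum_const, nsmul_eq_mul]

/-- The pure-algebra core of the Chebyshev step. [folklore] -/
theorem quarter_of_moments {Ωr Mr Qr nX K B c Br : ℝ} (hΩ : 0 < Ωr) (hc : 0 < c)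
    (f1 : nX * K ≤ Mr) (hK0 : 0 ≤ nX * K) (f2 : Qr ≤ c * Mr + nX ^ 2 * B) (f5 : B * Ωr ≤ K ^ 2)
    (hμ : 9 * c * Ωr ≤ Mr)
    (hbad : Br * (Mr / Ωr - 3 * c) ^ 2 ≤ Qr - 2 * (Mr / Ωr) * Mr + Ωr * (Mr / Ωr) ^ 2)
    (hBr : 0 ≤ Br) : 4 * Br ≤ Ωr := by
  set μ := Mr / Ωr with hμdef
  have hMμ : Mr = μ * Ωr := by rw [hμdef, div_mul_cancel₀ _ hΩ.ne']
  have hμ9 : 9 * c ≤ μ := by rw [hμdef, le_div_iff₀ hΩ]; linarith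
  have hμpos : 0 < μ := by nlinarith
  have hdev : Qr - 2 * μ * Mr + Ωr * μ ^ 2 = Qr - μ * Mr := by rw [hMμ]; ring
  rw [hdev] at hbad
  have h1 : nX ^ 2 * B ≤ μ * Mr := by
    have h1a : nX ^ 2 * B * Ωr ≤ (nX * K) ^ 2 := by nlinarith [f5, sq_nonneg nX]
    have h1b : (nX * K) ^ 2 ≤ Mr ^ 2 := pow_le_pow_left₀ hK0 f1 2
    have h1c : nX ^ 2 * B * Ωr ≤ (μ * Mr) * Ωr := by
      rw [hMμ]; nlinarith
    exact le_of_mul_le_mul_right h1c hΩ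
  have h2 : Br * (μ - 3 * c) ^ 2 ≤ c * Mr := by linarith
  have h3 : 2 * μ / 3 ≤ μ - 3 * c := by linarith
  have h4 : 4 * μ ^ 2 / 9 ≤ (μ - 3 * c) ^ 2 := by nlinarith
  have h5 : Br * (4 * μ ^ 2 / 9) ≤ c * (μ * Ωr) := by
    rw [← hMμ]; exact (mul_le_mul_of_nonneg_left h4 hBr).trans h2
  have h6 : c * (μ * Ωr) ≤ (μ / 9) * (μ * Ωr) :=
    mul_le_mul_of_nonneg_right (by linarith) (by positivity)
  have h7 := h5.trans h6
  have h8 : (4 * Br) * μ ^ 2 ≤ Ωr * μ ^ 2 := by nlinarith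
  exact le_of_mul_le_mul_right h8 (by positivity)

/-- **Chebyshev step.** If `X ⊆ F^m ∖ 0` has `(q+1)|X| ≥ 9(q^m − 1)` then at most a quarter of
the independent pairs see `≤ 3(q−1)` vectors of `X`. [folklore] -/
theorem four_mul_card_bad_le (hm : 2 ≤ m) (hq : 2 ≤ q) (X : Finset E) (hX0 : (0 : E) ∉ X)
    (hXbig : 9 * (q ^ m - 1) ≤ (q + 1) * X.card) : 4 * (Bad X).card ≤ (Omega F m).card := by
  have hq1 : (1 : ℝ) ≤ (q : ℝ) := by exact_mod_cast Fintype.card_pos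
  have hq2 : (2 : ℝ) ≤ (q : ℝ) := by exact_mod_cast hq
  have hΩpos : (0 : ℝ) < ((Omega F m).card : ℝ) := by
    exact_mod_cast (Omega_nonempty hm).card_pos
  -- casts of the natural-number quantities
  have hqle : q ≤ q ^ m := by
    calc q = q ^ 1 := (pow_one q).symm
      _ ≤ q ^ m := Nat.pow_le_pow_right Fintype.card_pos (by omega)
  have h1le : 1 ≤ q ^ m := Nat.one_le_pow _ _ Fintype.card_pos
  have h1le2 : 1 ≤ q ^ 2 := Nat.one_le_pow _ _ Fintype.card_pos
  have hqle2 : q ≤ q ^ 2 := by nlinarith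
  have cK : (((q ^ m - q) * (q ^ 2 - 1) : ℕ) : ℝ) = ((q : ℝ) ^ m - q) * ((q : ℝ) ^ 2 - 1) := by
    rw [Nat.cast_mul, Nat.cast_sub hqle, Nat.cast_sub h1le2]; push_cast; ring
  have cB : (((q ^ 2 - 1) * (q ^ 2 - q) : ℕ) : ℝ) = ((q : ℝ) ^ 2 - 1) * ((q : ℝ) ^ 2 - q) := by
    rw [Nat.cast_mul, Nat.cast_sub h1le2, Nat.cast_sub hqle2]; push_cast; ring
  have cΩ : (((q ^ m - 1) * (q ^ m - q) : ℕ) : ℝ) = ((q : ℝ) ^ m - 1) * ((q : ℝ) ^ m - q) := by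
    rw [Nat.cast_mul, Nat.cast_sub h1le, Nat.cast_sub hqle]; push_cast; ring
  have cq1 : (((q - 1 : ℕ)) : ℝ) = (q : ℝ) - 1 := by
    rw [Nat.cast_sub Fintype.card_pos]; push_cast; ring
  -- f1: first moment lower bound
  have f1 : (X.card : ℝ) * (((q : ℝ) ^ m - q) * ((q : ℝ) ^ 2 - 1)) ≤
      ∑ ω ∈ Omega F m, (sCount X ω : ℝ) := by
    have hnat : X.card * ((q ^ m - q) * (q ^ 2 - 1)) ≤ ∑ ω ∈ Omega F m, sCount X ω := by
      rw [sum_sCount, ← smul_eq_mul, ← sum_const]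
      exact sum_le_sum fun x hx => card_G_ge (fun h => hX0 (h ▸ hx))
    have := (Nat.cast_le (α := ℝ)).2 hnat
    rw [Nat.cast_mul, cK, Nat.cast_sum] at this
    exact this
  -- f2: second moment upper bound
  have f2 : ∑ ω ∈ Omega F m, (sCount X ω : ℝ) ^ 2 ≤ ((q : ℝ) - 1) * ∑ ω ∈ Omega F m, (sCount X ω : ℝ)
      + (X.card : ℝ) ^ 2 * (((q : ℝ) ^ 2 - 1) * ((q : ℝ) ^ 2 - q)) := by
    have := (Nat.cast_le (α := ℝ)).2 (sum_sCount_sq_le X hX0)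
    rw [Nat.cast_add, Nat.cast_mul, Nat.cast_mul, Nat.cast_mul, cB, cq1, Nat.cast_sum,
      Nat.cast_sum] at this
    simp only [Nat.cast_pow] at this
    rw [sq, mul_assoc]
    exact this
  -- f3: |Ω| ≤ (q^m-1)(q^m-q)
  have f3 : ((Omega F m).card : ℝ) ≤ ((q : ℝ) ^ m - 1) * ((q : ℝ) ^ m - q) := by
    have := (Nat.cast_le (α := ℝ)).2 (card_Omega_le (F := F) (m := m))
    rwa [cΩ] at this
  -- f4: B₂ (q^m-1)(q^m-q) ≤ K₁²
  have hqm : (q : ℝ) ^ 2 ≤ (q : ℝ) ^ m := by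
    exact_mod_cast Nat.pow_le_pow_right Fintype.card_pos hm
  have hA : (0 : ℝ) ≤ (q : ℝ) ^ 2 - 1 := by nlinarith
  have hB : (0 : ℝ) ≤ (q : ℝ) ^ m - q := by nlinarith
  have hC : (0 : ℝ) ≤ (q : ℝ) - 1 := by linarith
  have hD : (0 : ℝ) ≤ (q : ℝ) ^ m - (q : ℝ) ^ 2 := by linarith
  have f4 : (((q : ℝ) ^ 2 - 1) * ((q : ℝ) ^ 2 - q)) * (((q : ℝ) ^ m - 1) * ((q : ℝ) ^ m - q)) ≤
      (((q : ℝ) ^ m - q) * ((q : ℝ) ^ 2 - 1)) ^ 2 := by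
    have hid : (((q : ℝ) ^ m - q) * ((q : ℝ) ^ 2 - 1)) ^ 2 -
        (((q : ℝ) ^ 2 - 1) * ((q : ℝ) ^ 2 - q)) * (((q : ℝ) ^ m - 1) * ((q : ℝ) ^ m - q)) =
        ((q : ℝ) ^ 2 - 1) * ((q : ℝ) ^ m - q) * (((q : ℝ) - 1) * ((q : ℝ) ^ m - (q : ℝ) ^ 2)) := by
      ring
    have hprod := mul_nonneg (mul_nonneg hA hB) (mul_nonneg hC hD)
    rw [← hid] at hprod
    linarith
  have hB0 : (0 : ℝ) ≤ ((q : ℝ) ^ 2 - 1) * ((q : ℝ) ^ 2 - q) := mul_nonneg hA (by nlinarith)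
  have f5 : (((q : ℝ) ^ 2 - 1) * ((q : ℝ) ^ 2 - q)) * ((Omega F m).card : ℝ) ≤
      (((q : ℝ) ^ m - q) * ((q : ℝ) ^ 2 - 1)) ^ 2 :=
    (mul_le_mul_of_nonneg_left f3 hB0).trans f4
  -- hμ: 9 (q-1) |Ω| ≤ M
  have hXbig' : 9 * ((q : ℝ) ^ m - 1) ≤ ((q : ℝ) + 1) * X.card := by
    have := (Nat.cast_le (α := ℝ)).2 hXbig
    rw [Nat.cast_mul, Nat.cast_mul, Nat.cast_sub h1le] at this
    push_cast at this
    linarith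
  have hμ : 9 * ((q : ℝ) - 1) * ((Omega F m).card : ℝ) ≤ ∑ ω ∈ Omega F m, (sCount X ω : ℝ) := by
    have hE : (0 : ℝ) ≤ ((q : ℝ) - 1) * ((q : ℝ) ^ m - q) := mul_nonneg hC hB
    calc 9 * ((q : ℝ) - 1) * ((Omega F m).card : ℝ)
        ≤ 9 * ((q : ℝ) - 1) * (((q : ℝ) ^ m - 1) * ((q : ℝ) ^ m - q)) :=
          mul_le_mul_of_nonneg_left f3 (by linarith)
      _ = (9 * ((q : ℝ) ^ m - 1)) * (((q : ℝ) - 1) * ((q : ℝ) ^ m - q)) := by ring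
      _ ≤ (((q : ℝ) + 1) * X.card) * (((q : ℝ) - 1) * ((q : ℝ) ^ m - q)) :=
          mul_le_mul_of_nonneg_right hXbig' hE
      _ = (X.card : ℝ) * (((q : ℝ) ^ m - q) * ((q : ℝ) ^ 2 - 1)) := by ring
      _ ≤ _ := f1
  -- hbad: bad pairs deviate
  have hbad : ((Bad X).card : ℝ) *
      ((∑ ω ∈ Omega F m, (sCount X ω : ℝ)) / ((Omega F m).card : ℝ) - 3 * ((q : ℝ) - 1)) ^ 2 ≤
      ∑ ω ∈ Omega F m, (sCount X ω : ℝ) ^ 2 -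
        2 * ((∑ ω ∈ Omega F m, (sCount X ω : ℝ)) / ((Omega F m).card : ℝ)) *
          ∑ ω ∈ Omega F m, (sCount X ω : ℝ) +
        ((Omega F m).card : ℝ) *
          ((∑ ω ∈ Omega F m, (sCount X ω : ℝ)) / ((Omega F m).card : ℝ)) ^ 2 := by
    set μ : ℝ := (∑ ω ∈ Omega F m, (sCount X ω : ℝ)) / ((Omega F m).card : ℝ) with hμdef
    have hθμ : 3 * ((q : ℝ) - 1) ≤ μ := by
      rw [hμdef, le_div_iff₀ hΩpos]
      have h0 : (0 : ℝ) ≤ ((q : ℝ) - 1) * ((Omega F m).card : ℝ) := mul_nonneg hC hΩpos.le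
      linarith
    rw [← sum_sq_sub]
    calc ((Bad X).card : ℝ) * (μ - 3 * ((q : ℝ) - 1)) ^ 2
        = ∑ _ω ∈ Bad X, (μ - 3 * ((q : ℝ) - 1)) ^ 2 := by rw [sum_const, nsmul_eq_mul]
      _ ≤ ∑ ω ∈ Bad X, ((sCount X ω : ℝ) - μ) ^ 2 := by
          refine sum_le_sum fun ω hω => ?_
          have hs : (sCount X ω : ℝ) ≤ 3 * ((q : ℝ) - 1) := by
            have := (Nat.cast_le (α := ℝ)).2 (mem_filter.1 hω).2
            rw [Nat.cast_mul, cq1] at this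
            push_cast at this
            linarith
          nlinarith
      _ ≤ ∑ ω ∈ Omega F m, ((sCount X ω : ℝ) - μ) ^ 2 :=
          sum_le_sum_of_subset_of_nonneg (filter_subset _ _) fun _ _ _ => sq_nonneg _
  have hfin := quarter_of_moments hΩpos (by linarith) f1
    (mul_nonneg (Nat.cast_nonneg _) (mul_nonneg hB hA)) f2 f5 hμ hbad (Nat.cast_nonneg _)
  exact_mod_cast hfin


variable {N : ℕ} {V W U : Fin N → Submodule F (Fin m → F)} {A B C : Fin N → Finset (Fin m → F)}

/-! # (M3) From a rich pair to four lines; three dense colour classes are impossible -/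

omit [Fintype F] in
/-- Non-proportionality is symmetric between non-zero vectors. [folklore] -/
theorem not_prop_symm {x y : E} (hy : y ≠ 0) (h : ∀ c : F, x ≠ c • y) : ∀ c : F, y ≠ c • x := by
  intro c hyc
  have hc : c ≠ 0 := by rintro rfl; rw [zero_smul] at hyc; exact hy hyc
  exact h c⁻¹ (by rw [hyc, smul_smul, inv_mul_cancel₀ hc, one_smul])

/-- In a set `Y` of non-zero vectors with `|Y| > n(q−1)`, some element is proportional to none of
`n` given vectors. [folklore] -/
theorem exists_not_prop (Y : Finset E) (hY0 : (0 : E) ∉ Y) {n : ℕ} (vs : Fin n → E)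
    (hY : n * (q - 1) < Y.card) : ∃ w ∈ Y, ∀ i, ∀ c : F, w ≠ c • vs i := by
  by_contra hcon
  push Not at hcon
  -- Y ⊆ ⋃ᵢ (line (vs i)).erase 0
  have hsub : Y ⊆ (univ : Finset (Fin n)).biUnion fun i => (lineOf (vs i)).erase 0 := by
    intro w hw
    obtain ⟨i, c, hc⟩ := hcon w hw
    exact mem_biUnion.2 ⟨i, mem_univ _, mem_erase.2 ⟨fun h => hY0 (h ▸ hw), mem_lineOf.2 ⟨c, hc⟩⟩⟩
  have hcard : ((univ : Finset (Fin n)).biUnion fun i => (lineOf (vs i)).erase 0).card ≤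
      n * (q - 1) := by
    refine card_biUnion_le.trans ?_
    calc ∑ i, ((lineOf (vs i)).erase 0).card ≤ ∑ _i : Fin n, (q - 1) := by
          refine sum_le_sum fun i _ => ?_
          by_cases h0 : vs i = 0
          · have : lineOf (vs i) = {0} := by
              ext w; simp [mem_lineOf, h0]
            rw [this]; simp
          · rw [card_erase_of_mem (zero_mem_lineOf _), card_lineOf h0]
      _ = n * (q - 1) := by rw [sum_const, card_univ, Fintype.card_fin, smul_eq_mul]
  exact absurd ((card_le_card hsub).trans hcard) (not_le.2 hY)

/-- **Four lines from a rich pair**: if the pair `(y, z)` sees `> 3(q−1)` vectors of `X ∌ 0`, then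
`X ∩ span(y,z)` contains four pairwise non-proportional vectors. [folklore] -/
theorem four_nonprop (X : Finset E) (hX0 : (0 : E) ∉ X) {y z : E}
    (hrich : 3 * (q - 1) < sCount X (y, z)) :
    ∃ σ : Fin 4 → E, (∀ a, σ a ∈ X ∧ σ a ∈ Submodule.span F ({y, z} : Set E)) ∧
      ∀ a b, a ≠ b → ∀ c : F, σ a ≠ c • σ b := by
  set Y := X.filter fun x => x ∈ Submodule.span F ({y, z} : Set E) with hY
  have hY0 : (0 : E) ∉ Y := fun h => hX0 (mem_filter.1 h).1
  have hYc : 3 * (q - 1) < Y.card := hrich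
  have hq1 : 1 ≤ q := Fintype.card_pos
  obtain ⟨s0, hs0, -⟩ := exists_not_prop Y hY0 (n := 0) Fin.elim0 (by omega)
  obtain ⟨s1, hs1, h1⟩ := exists_not_prop Y hY0 ![s0] (by simp; omega)
  obtain ⟨s2, hs2, h2⟩ := exists_not_prop Y hY0 ![s0, s1] (by simp; omega)
  obtain ⟨s3, hs3, h3⟩ := exists_not_prop Y hY0 ![s0, s1, s2] (by simp; omega)
  have ne0 : ∀ {w}, w ∈ Y → w ≠ (0 : E) := fun hw h => hY0 (h ▸ hw)
  refine ⟨![s0, s1, s2, s3], fun a => ?_, ?_⟩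
  · fin_cases a <;> simp [hY] at hs0 hs1 hs2 hs3 ⊢ <;> assumption
  · have h10 := h1 0; have h20 := h2 0; have h21 := h2 1
    have h30 := h3 0; have h31 := h3 1; have h32 := h3 2
    simp at h10 h20 h21 h30 h31 h32
    intro a b hab
    fin_cases a <;> fin_cases b <;> simp at hab ⊢
    · exact not_prop_symm (ne0 hs0) h10
    · exact not_prop_symm (ne0 hs0) h20
    · exact not_prop_symm (ne0 hs0) h30
    · exact h10
    · exact not_prop_symm (ne0 hs1) h21
    · exact not_prop_symm (ne0 hs1) h31
    · exact h20
    · exact h21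
    · exact not_prop_symm (ne0 hs2) h32
    · exact h30
    · exact h31
    · exact h32

/-- **Three dense colour classes are impossible** (richness + Chebyshev): in an STPP
punctured-subspace frame family over `F` (`|F| ≥ 3`, `m ≥ 2`), three sets `XS ⊆ ⋃(A_i − B_i)`,
`XT ⊆ ⋃(B_j − C_j)`, `XU ⊆ ⋃(C_k − A_k)` of non-zero vectors cannot all have
`(q+1)|X| ≥ 9(q^m − 1)`. [folklore] -/
theorem threeDense_false (hF : 3 ≤ q) (hm : 2 ≤ m) (hS : IsSTPP A B C)
    (hA : ∀ i v, v ∈ A i ↔ v ∈ V i ∧ v ≠ 0) (hB : ∀ i v, v ∈ B i ↔ v ∈ W i ∧ v ≠ 0)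
    (hC : ∀ i v, v ∈ C i ↔ v ∈ U i ∧ v ≠ 0)
    (XS XT XU : Finset E) (hS0 : (0 : E) ∉ XS) (hT0 : (0 : E) ∉ XT) (hU0 : (0 : E) ∉ XU)
    (hSm : ∀ σ ∈ XS, ∃ i, σ ∈ diffSet A B i) (hTm : ∀ τ ∈ XT, ∃ j, τ ∈ diffSet B C j)
    (hUm : ∀ υ ∈ XU, ∃ k, υ ∈ diffSet C A k)
    (hSbig : 9 * (q ^ m - 1) ≤ (q + 1) * XS.card) (hTbig : 9 * (q ^ m - 1) ≤ (q + 1) * XT.card)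
    (hUbig : 9 * (q ^ m - 1) ≤ (q + 1) * XU.card) : False := by
  have hq2 : 2 ≤ q := by omega
  have bS := four_mul_card_bad_le hm hq2 XS hS0 hSbig
  have bT := four_mul_card_bad_le hm hq2 XT hT0 hTbig
  have bU := four_mul_card_bad_le hm hq2 XU hU0 hUbig
  -- a pair outside the three bad sets
  have hgood : ∃ ω ∈ Omega F m, ω ∉ Bad XS ∧ ω ∉ Bad XT ∧ ω ∉ Bad XU := by
    by_contra hcon
    push Not at hcon
    have hsub : Omega F m ⊆ Bad XS ∪ Bad XT ∪ Bad XU := by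
      intro ω hω
      by_cases h1 : ω ∈ Bad XS
      · exact mem_union_left _ (mem_union_left _ h1)
      by_cases h2 : ω ∈ Bad XT
      · exact mem_union_left _ (mem_union_right _ h2)
      · exact mem_union_right _ (hcon ω hω h1 h2)
    have h1 := card_le_card hsub
    have h2 := card_union_le (Bad XS ∪ Bad XT) (Bad XU)
    have h3 := card_union_le (Bad XS) (Bad XT)
    have hpos := (Omega_nonempty (F := F) hm).card_pos
    omega
  obtain ⟨⟨y, z⟩, hω, nS, nT, nU⟩ := hgood
  have hind := mk_mem_Omega.1 hω
  have rich : ∀ {X : Finset E}, (y, z) ∉ Bad X → 3 * (q - 1) < sCount X (y, z) := by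
    intro X h
    by_contra hle
    exact h (mem_filter.2 ⟨hω, not_lt.1 hle⟩)
  obtain ⟨σ, hσ, nσ⟩ := four_nonprop XS hS0 (rich nS)
  obtain ⟨τ, hτ, nτ⟩ := four_nonprop XT hT0 (rich nT)
  obtain ⟨υ, hυ, nυ⟩ := four_nonprop XU hU0 (rich nU)
  -- the plane
  let P : Submodule F E := Submodule.span F (Set.range ![y, z])
  have hP : Module.finrank F P = 2 := by
    simp only [P]
    rw [finrank_span_eq_card hind]
    simp
  have memP : ∀ {w : E}, w ∈ Submodule.span F ({y, z} : Set E) → w ∈ P := by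
    intro w hw
    obtain ⟨a, b, rfl⟩ := mem_span_pair'.1 hw
    refine Submodule.add_mem _ (Submodule.smul_mem _ _ (Submodule.subset_span ⟨0, rfl⟩))
      (Submodule.smul_mem _ _ (Submodule.subset_span ⟨1, rfl⟩))
  choose iS hiS using fun a => hSm (σ a) (hσ a).1
  choose iT hiT using fun a => hTm (τ a) (hτ a).1
  choose iU hiU using fun a => hUm (υ a) (hυ a).1
  exact richness hF hS hA hB hC hP σ τ υ iS iT iU hiS hiT hiU (fun a => memP (hσ a).2)
    (fun a => memP (hτ a).2) (fun a => memP (hυ a).2) nσ nτ nυ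

/-! # (M4) Colour classes as Finsets -/

/-- The colour class `⋃ᵢ (X_i − Y_i)` of a family. [folklore] -/
def colour (X Y : Fin N → Finset E) : Finset E :=
  univ.biUnion fun i => ((X i) ×ˢ (Y i)).image fun p => p.1 - p.2

omit [Fintype F] in
/-- Helper `mem_colour` of the bounded-rank frame count. [folklore] -/
theorem mem_colour {X Y : Fin N → Finset E} {σ : E} : σ ∈ colour X Y ↔ ∃ i, σ ∈ diffSet X Y i := by
  simp only [colour, mem_biUnion, mem_univ, true_and, mem_image, mem_product, Prod.exists, diffSet,
    Set.mem_setOf_eq]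
  constructor
  · rintro ⟨i, a, b, ⟨ha, hb⟩, rfl⟩; exact ⟨i, a, ha, b, hb, rfl⟩
  · rintro ⟨i, a, ha, b, hb, rfl⟩; exact ⟨i, a, b, ⟨ha, hb⟩, rfl⟩

omit [Fintype F] in
/-- The packing injectivity `(i, a, b) ↦ a − b` (the STPP clause at `(i, k, k)`). [folklore] -/
theorem sub_inj (hS : IsSTPP A B C) (hCne : ∀ i, (C i).Nonempty) {i k : Fin N} {a b a' b' : E}
    (ha : a ∈ A i) (hb : b ∈ B i) (ha' : a' ∈ A k) (hb' : b' ∈ B k) (h : a - b = a' - b') :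
    i = k ∧ a = a' ∧ b = b' := by
  obtain ⟨u, hu⟩ := hCne k
  have := hS i k k a' ha' a ha b hb b' hb' u hu u hu
    (by rw [sub_self, add_zero]; rw [sub_eq_sub_iff_add_eq_add] at h; linear_combination h)
  exact ⟨this.1, this.2.2.1.symm, this.2.2.2.1⟩

omit [Fintype F] in
/-- `|⋃ᵢ (A_i − B_i)| = Σᵢ |A_i||B_i|`. [folklore] -/
theorem card_colour (hS : IsSTPP A B C) (hCne : ∀ i, (C i).Nonempty) :
    (colour A B).card = ∑ i, (A i).card * (B i).card := by
  rw [colour, card_biUnion]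
  · refine sum_congr rfl fun i _ => ?_
    rw [card_image_of_injOn, card_product]
    rintro ⟨a, b⟩ hab ⟨a', b'⟩ hab' h
    simp only [mem_coe, mem_product] at hab hab'
    obtain ⟨-, h1, h2⟩ := sub_inj hS hCne hab.1 hab.2 hab'.1 hab'.2 h
    rw [h1, h2]
  · intro i _ k _ hik
    change Disjoint _ _
    rw [Finset.disjoint_left]
    intro σ h1 h2
    obtain ⟨⟨a, b⟩, hab, rfl⟩ := mem_image.1 h1
    obtain ⟨⟨a', b'⟩, hab', h⟩ := mem_image.1 h2
    simp only [mem_product] at hab hab'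
    exact hik (sub_inj hS hCne hab.1 hab.2 hab'.1 hab'.2 h.symm).1

/-- `0 ∉ ⋃ᵢ (A_i − B_i)` for a family with non-empty sets (`|F| ≥ 3`). [folklore] -/
theorem zero_not_mem_colour (hF : 3 ≤ q) (hS : IsSTPP A B C)
    (hA : ∀ i v, v ∈ A i ↔ v ∈ V i ∧ v ≠ 0) (hB : ∀ i v, v ∈ B i ↔ v ∈ W i ∧ v ≠ 0)
    (hC : ∀ i v, v ∈ C i ↔ v ∈ U i ∧ v ≠ 0)
    (hne : ∀ i, (A i).Nonempty ∧ (B i).Nonempty ∧ (C i).Nonempty) : (0 : E) ∉ colour A B := by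
  intro h0
  obtain ⟨i, a, ha, b, hb, hab⟩ := mem_colour.1 h0
  have ha' := (hA i a).1 ha
  have hb' := (hB i b).1 hb
  have := (directSum_of_stpp hF hS hA hB hC (hne i).1 (hne i).2.1 (hne i).2.2 ha'.1
    ((W i).neg_mem hb'.1) (U i).zero_mem (by rw [add_zero, ← sub_eq_add_neg, ← hab])).1
  exact ha'.2 this

/-- **Packing defect for STPP frame families**: over `F` with `|F| ≥ 3`, `m ≥ 2`, an STPP family of
punctured-subspace frames with non-empty sets has `(q+1) Σᵢ |X_i||Y_i| < 9 (q^m − 1)` for one of the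
three pairings — a factor `≈ q/9` below the packing bound `Σ |X_i||Y_i| ≤ q^m`. [folklore] -/
theorem frame_packing_defect (hF : 3 ≤ q) (hm : 2 ≤ m) (hS : IsSTPP A B C)
    (hA : ∀ i v, v ∈ A i ↔ v ∈ V i ∧ v ≠ 0) (hB : ∀ i v, v ∈ B i ↔ v ∈ W i ∧ v ≠ 0)
    (hC : ∀ i v, v ∈ C i ↔ v ∈ U i ∧ v ≠ 0)
    (hne : ∀ i, (A i).Nonempty ∧ (B i).Nonempty ∧ (C i).Nonempty) :
    (q + 1) * ∑ i, (A i).card * (B i).card < 9 * (q ^ m - 1) ∨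
    (q + 1) * ∑ i, (B i).card * (C i).card < 9 * (q ^ m - 1) ∨
    (q + 1) * ∑ i, (C i).card * (A i).card < 9 * (q ^ m - 1) := by
  by_contra hcon
  push Not at hcon
  obtain ⟨h1, h2, h3⟩ := hcon
  have hS2 : IsSTPP B C A := hS.rotate
  have hS3 : IsSTPP C A B := hS2.rotate
  have hne2 : ∀ i, (B i).Nonempty ∧ (C i).Nonempty ∧ (A i).Nonempty :=
    fun i => ⟨(hne i).2.1, (hne i).2.2, (hne i).1⟩
  have hne3 : ∀ i, (C i).Nonempty ∧ (A i).Nonempty ∧ (B i).Nonempty :=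
    fun i => ⟨(hne i).2.2, (hne i).1, (hne i).2.1⟩
  refine threeDense_false hF hm hS hA hB hC (colour A B) (colour B C) (colour C A)
    (zero_not_mem_colour hF hS hA hB hC hne) (zero_not_mem_colour hF hS2 hB hC hA hne2)
    (zero_not_mem_colour hF hS3 hC hA hB hne3)
    (fun σ h => mem_colour.1 h) (fun τ h => mem_colour.1 h) (fun υ h => mem_colour.1 h) ?_ ?_ ?_
  · rwa [card_colour hS fun i => (hne i).2.2]
  · rwa [card_colour hS2 fun i => (hne i).1]
  · rwa [card_colour hS3 fun i => (hne i).2.1]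

/-! # (M5) Assembly: FrameBarrier -/

/-- STPP restricts along injective re-indexings. [folklore] -/
theorem isSTPP_comp_inj {H : Type*} [AddCommGroup H] {M N : ℕ} {A B C : Fin M → Finset H}
    (h : IsSTPP A B C) {κ : Fin N → Fin M} (hκ : Function.Injective κ) :
    IsSTPP (fun i => A (κ i)) (fun i => B (κ i)) (fun i => C (κ i)) := by
  intro i j k s hs s' hs' t ht t' ht' u hu u' hu' he
  obtain ⟨h1, h2, h3, h4, h5⟩ := h (κ i) (κ j) (κ k) s hs s' hs' t ht t' ht' u hu u' hu' he
  exact ⟨hκ h1, hκ h2, h3, h4, h5⟩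

/-- In rank `m ≤ 1` no block has three non-empty sets (`|F| ≥ 3`). [folklore] -/
theorem no_full_block (hF : 3 ≤ q) (hm : m < 2) (hS : IsSTPP A B C)
    (hA : ∀ i v, v ∈ A i ↔ v ∈ V i ∧ v ≠ 0) (hB : ∀ i v, v ∈ B i ↔ v ∈ W i ∧ v ≠ 0)
    (hC : ∀ i v, v ∈ C i ↔ v ∈ U i ∧ v ≠ 0) (i : Fin N) :
    ¬ ((A i).Nonempty ∧ (B i).Nonempty ∧ (C i).Nonempty) := by
  rintro ⟨⟨a, ha⟩, ⟨b, hb⟩, hCi⟩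
  have ha' := (hA i a).1 ha
  have hb' := (hB i b).1 hb
  interval_cases m
  · exact ha'.2 (Subsingleton.elim a 0)
  · have ha0 : a 0 ≠ 0 := by
      intro h; apply ha'.2; funext j; fin_cases j; simpa using h
    set c : F := b 0 * (a 0)⁻¹ with hc
    have hbca : b = c • a := by
      funext j; fin_cases j
      simp [hc, mul_assoc, inv_mul_cancel₀ ha0]
    have := (directSum_of_stpp hF hS hA hB hC ⟨a, ha⟩ ⟨b, hb⟩ hCi ((V i).smul_mem c ha'.1)
      ((W i).neg_mem hb'.1) (U i).zero_mem (by rw [add_zero, ← hbca, add_neg_cancel])).2.1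
    exact hb'.2 (neg_eq_zero.1 this)

/-- Real bookkeeping: `(q+1) Σ < 9(q^m − 1)` and `q ≥ 81`, `m ≥ 2` give
`Σ ≤ (q^m)^{1 − 3ε'}` with `ε' = 1/(6m+6)`. [folklore] -/
theorem defect_real {qn m : ℕ} (hq : 81 ≤ qn) (hm : 2 ≤ m) {Sn : ℕ}
    (h : (qn + 1) * Sn < 9 * (qn ^ m - 1)) :
    (Sn : ℝ) ≤ ((qn : ℝ) ^ m) ^ (1 - 3 * (1 / (6 * (m : ℝ) + 6))) := by
  have hQ : (81 : ℝ) ≤ qn := by exact_mod_cast hq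
  have hQpos : (0 : ℝ) < qn := by linarith
  -- step a: Sn ≤ 9 q^(m-1)
  obtain ⟨k, rfl⟩ : ∃ k, m = k + 1 := ⟨m - 1, by omega⟩
  have hnat : (qn + 1) * Sn ≤ 9 * qn ^ (k + 1) :=
    (le_of_lt h).trans (Nat.mul_le_mul_left 9 (Nat.sub_le _ _))
  have ha : (Sn : ℝ) ≤ 9 * (qn : ℝ) ^ k := by
    have h1 : ((qn : ℝ) + 1) * Sn ≤ 9 * (qn : ℝ) ^ (k + 1) := by exact_mod_cast hnat
    rw [pow_succ] at h1
    -- (q+1) Sn ≤ 9 q^k q ≤ 9 q^k (q+1)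
    have h2 : 9 * ((qn : ℝ) ^ k * qn) ≤ 9 * (qn : ℝ) ^ k * ((qn : ℝ) + 1) := by
      nlinarith [pow_nonneg hQpos.le k]
    have h3 : ((qn : ℝ) + 1) * Sn ≤ ((qn : ℝ) + 1) * (9 * (qn : ℝ) ^ k) := by linarith
    exact le_of_mul_le_mul_left h3 (by linarith)
  -- step b: 9 q^k ≤ (q^(k+1))^(1-3ε')
  have hexp : ((qn : ℝ) ^ (k + 1)) ^ (1 - 3 * (1 / (6 * ((k + 1 : ℕ) : ℝ) + 6))) =
      (qn : ℝ) ^ (((k + 1 : ℕ) : ℝ) * (1 - 3 * (1 / (6 * ((k + 1 : ℕ) : ℝ) + 6)))) := by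
    rw [← Real.rpow_natCast, ← Real.rpow_mul hQpos.le]
  rw [hexp]
  set e : ℝ := ((k + 1 : ℕ) : ℝ) * (1 - 3 * (1 / (6 * ((k + 1 : ℕ) : ℝ) + 6))) with he
  have hk0 : (0 : ℝ) ≤ k := Nat.cast_nonneg k
  have he_ge : (k : ℝ) + 1 / 2 ≤ e := by
    rw [he]; push_cast
    rw [← sub_nonneg]
    have hne : (2 : ℝ) * k + 4 ≠ 0 := by positivity
    have hne' : (6 : ℝ) * (k + 1) + 6 ≠ 0 := by positivity
    have : ((k : ℝ) + 1) * (1 - 3 * (1 / (6 * ((k : ℝ) + 1) + 6))) - ((k : ℝ) + 1 / 2) =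
        1 / (2 * (k : ℝ) + 4) := by
      rw [eq_div_iff hne]
      field_simp
      ring
    rw [this]; positivity
  have h9 : (9 : ℝ) ≤ (qn : ℝ) ^ (1 / 2 : ℝ) := by
    have : (9 : ℝ) = (81 : ℝ) ^ (1 / 2 : ℝ) := by
      rw [show (81 : ℝ) = 9 ^ 2 by norm_num, ← Real.rpow_natCast, ← Real.rpow_mul (by norm_num)]
      norm_num
    rw [this]
    exact Real.rpow_le_rpow (by norm_num) hQ (by norm_num)
  calc (Sn : ℝ) ≤ 9 * (qn : ℝ) ^ k := ha
    _ ≤ (qn : ℝ) ^ (1 / 2 : ℝ) * (qn : ℝ) ^ k := mul_le_mul_of_nonneg_right h9 (by positivity)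
    _ = (qn : ℝ) ^ ((k : ℝ) + 1 / 2) := by
        rw [Real.rpow_add hQpos, Real.rpow_natCast, mul_comm]
    _ ≤ (qn : ℝ) ^ e := Real.rpow_le_rpow_of_exponent_le (by linarith) he_ge


end Count

end STPPFrame

/-! ## Catalogue entry (D-0021) -/

section Catalogue

open scoped Classical
open STPPFrame

/-- **STPP frame families in bounded rank have a power-saving packing defect; in particular no
dimension-exact STPP frame design exists in any fixed rank (this project, 2026; proved below).**
The statement is literally the route decl `AlgebraicSTPPDichotomy.FrameBarrier`: for every rank
`m` there are `ε > 0` (here `2/(6m+5)`) and `q₀` (here `81`) such that for every finite field `F`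
with `|F| ≥ q₀` and every STPP family of punctured-subspace frames `(V_i ∖ 0, W_i ∖ 0, U_i ∖ 0)`
in `F^m`, `Σ_i (|A_i||B_i||C_i|)^{(2+ε)/3} ≤ |F|^m`.

BARRIER
technique_class: group-theoretic-approach, abelian-STPP, bounded-RANK hosts `F_q^m` (`m` fixed, `q → ∞`, any characteristic), designs whose sets are punctured subspaces ("frames": `A_i = V_i ∖ 0`), in particular punctured lines `F^× a_i`, polynomial / definable-by-linear-algebra frame families
blocks: certifying `ω < 2 + ε_m` (let alone `ω = 2`) from an STPP frame family in `F_q^m` via the Cohn–Kleinberg–Szegedy–Umans inequality `Σ_i (|A_i||B_i||C_i|)^{ω/3} ≤ |H|` [cite: CohnKleinbergSzegedyUmans2005, Thm. 5.5]: every such family has `Σ_i (|A_i||B_i||C_i|)^{(2+ε_m)/3} ≤ q^m` once `q ≥ 81` (`boundedRankFrameBarrier_holds`), because one of the three packing sums `Σ|A_i||B_i|, Σ|B_i||C_i|, Σ|C_i||A_i|` is `< 9(q^m−1)/(q+1)`, a factor `≈ q/9` below the packing bound `≤ q^m` [cite: BlasiakChurchCohnGrochowNaslundSawinUmans2017, Lemma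 2.4] (`STPPFrame.frame_packing_defect`); so dimension-exact frame designs (index set of size `q^{m−2v/3+o(1)}`) do not exist in any bounded rank, and at most `9q^{m−3}(1+o(1))` STPP punctured-line triples fit in `F_q^m`.
because: RICHNESS — in an STPP frame family no 2-dimensional `P ≤ F^m` contains four lines of each colour class `S = ⋃(A_i−B_i)`, `T = ⋃(B_j−C_j)`, `U = ⋃(C_k−A_k)` (three pairwise distinct lines of a plane in `S_i, T_j, U_k` carry `σ+τ+υ = 0` with all three non-zero, which the STPP clause [cite: CohnKleinbergSzegedyUmans2005, Def. 5.1] forbids unless `i=j=k`; four lines per colour force one label `i` and `P ≤ (V_i⊕W_i) ∩ (W_i⊕U_i) = W_i`, disjoint from `S_i`) (`STPPFrame.richness`); SECOND MOMENT — over ordered independent pairs `(y,z)`, a set `X` of non-zero vectors with `(q+1)|X| ≥ 9(q^m−1)` has mean `≥ 9(q−1)` members in `span(y,z)` and variance `≤ (q−1)·mean` (each `v ≠ 0` lies in `≥ (q^m−q)(q²−1)` pair-spans, two independent vectors in `≤ (q²−1)(q²−q)`), so by Chebyshev at most a quarter of the pairs see `≤ 3(q−1)` members of `X` (`STPPFrame.four_mul_card_bad_le`);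 if all three colour classes were that dense some pair would be rich in all three, contradicting richness; the defect then feeds BCCGNSU Lemma 2.4 in effective form (`IsSTPP.sum_rpow_le_card_of_packing_defect`) [cite: BlasiakChurchCohnGrochowNaslundSawinUmans2017, Lemma 2.4].
evasions_known: sets that are NOT cones over subspaces (arbitrary subsets of `F_q^m`, e.g. CKSU's local/USP designs at unbounded rank [cite: CohnKleinbergSzegedyUmans2005, §7], or definable non-linear sets such as tori and norm-one hypersurfaces) — the richness step uses that the colour classes are unions of punctured 2-planes-minus-axes closed under `F^×` and that TPP forces `V_i ⊕ W_i ⊕ U_i` direct; unbounded rank `m → ∞` with `q` fixed is the complementary regime of Thm B [cite: BlasiakChurchCohnGrochowNaslundSawinUmans2017, Thm. B]; non-abelian hosts are untouched.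
scope_caveats: (a) `ε_m = 2/(6m+5) → 0` as `m → ∞`: the entry does not bound `ω` away from 2 uniformly in the rank (whether the true exponent defect of frames is bounded below by an absolute constant is open; two full frames show `ε ≤ 1` is necessary); (b) `q₀ = 81` and the constant `9` are not optimised; (c) the sets must be exactly punctured subspaces (no further deletions inside blocks); (d) only the inequality route `Σ(|A||B||C|)^{ω/3} ≤ |H|` through STPP in the abelian group `F_q^m` is blocked [cite: CohnKleinbergSzegedyUmans2005, Thm. 5.5].
status: theorem (established; proved in this file, `boundedRankFrameBarrier_holds`) [folklore] -/
def BoundedRankFrameBarrier : Prop :=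
  ∀ m : ℕ, ∃ ε : ℝ, 0 < ε ∧ ∃ q₀ : ℕ, ∀ (F : Type) [Field F] [Fintype F], q₀ ≤ Fintype.card F →
    ∀ (N : ℕ) (V W U : Fin N → Submodule F (Fin m → F)) (A B C : Fin N → Finset (Fin m → F)),
    (∀ i v, v ∈ A i ↔ v ∈ V i ∧ v ≠ 0) → (∀ i v, v ∈ B i ↔ v ∈ W i ∧ v ≠ 0) →
    (∀ i v, v ∈ C i ↔ v ∈ U i ∧ v ≠ 0) → IsSTPP A B C →
      ∑ i, (((A i).card * (B i).card * (C i).card : ℕ) : ℝ) ^ ((2 + ε) / 3) ≤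
        (Fintype.card F : ℝ) ^ m

/-- **The bounded-rank frame barrier holds** (`ε_m = 2/(6m+5)`, `q₀ = 81`): blocks with an
empty set contribute `0`; the full blocks form an STPP family with a packing defect
`(q+1) Σ |X_i||Y_i| < 9 (q^m − 1) ≤ (q^m)^{1−3ε'}`, `ε' = 1/(6m+6)`, in some pairing
(`frame_packing_defect`), and BCCGNSU Lemma 2.4 in effective form (after `rotate`) gives the bound at
exponent `2/(1−ε') = 2 + 2/(6m+5)`; rank `m ≤ 1` has no full block. [folklore] -/
theorem boundedRankFrameBarrier_holds : BoundedRankFrameBarrier := by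
  intro m
  refine ⟨2 / (6 * (m : ℝ) + 5), by positivity, 81, ?_⟩
  intro F _ _ hq N V W U A B C hA hB hC hS
  classical
  have hF3 : 3 ≤ Fintype.card F := le_trans (by norm_num) hq
  set ex : ℝ := (2 + 2 / (6 * (m : ℝ) + 5)) / 3 with hex
  have hex0 : 0 < ex := by rw [hex]; positivity
  -- full blocks
  let J : Finset (Fin N) := univ.filter fun i => (A i).Nonempty ∧ (B i).Nonempty ∧ (C i).Nonempty
  have hzero : ∀ i, i ∉ J → (((A i).card * (B i).card * (C i).card : ℕ) : ℝ) ^ ex = 0 := by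
    intro i hi
    have : (A i).card * (B i).card * (C i).card = 0 := by
      simp only [J, mem_filter, mem_univ, true_and, not_and_or, not_nonempty_iff_eq_empty] at hi
      rcases hi with h | h | h <;> simp [h]
    rw [this, Nat.cast_zero, Real.zero_rpow hex0.ne']
  have hsumJ : ∑ i, (((A i).card * (B i).card * (C i).card : ℕ) : ℝ) ^ ex =
      ∑ i ∈ J, (((A i).card * (B i).card * (C i).card : ℕ) : ℝ) ^ ex :=
    (sum_subset (subset_univ J) fun i _ hi => hzero i hi).symm
  -- re-index the full blocks
  set N' := J.card
  let e : Fin N' ≃ J := J.equivFin.symm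
  let κ : Fin N' → Fin N := fun j => (e j : Fin N)
  have hκ : Function.Injective κ := Subtype.val_injective.comp e.injective
  have hκJ : ∀ j, κ j ∈ J := fun j => (e j).2
  have hsum' : ∑ i ∈ J, (((A i).card * (B i).card * (C i).card : ℕ) : ℝ) ^ ex =
      ∑ j : Fin N', (((A (κ j)).card * (B (κ j)).card * (C (κ j)).card : ℕ) : ℝ) ^ ex := by
    rw [← sum_coe_sort J]
    exact (Fintype.sum_equiv e _ _ fun j => rfl).symm
  have hS' : IsSTPP (fun j => A (κ j)) (fun j => B (κ j)) (fun j => C (κ j)) :=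
    isSTPP_comp_inj hS hκ
  have hne' : ∀ j, (A (κ j)).Nonempty ∧ (B (κ j)).Nonempty ∧ (C (κ j)).Nonempty :=
    fun j => (mem_filter.1 (hκJ j)).2
  have hcard : (Fintype.card (Fin m → F) : ℝ) = (Fintype.card F : ℝ) ^ m := by
    rw [Fintype.card_fun, Fintype.card_fin]; push_cast; rfl
  change ∑ i, (((A i).card * (B i).card * (C i).card : ℕ) : ℝ) ^ ex ≤ _
  rw [hsumJ, hsum']
  rcases lt_or_ge m 2 with hm | hm
  · -- rank ≤ 1: no full block
    have : N' = 0 := by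
      simp only [N', card_eq_zero, J, filter_eq_empty_iff]
      intro i _
      exact no_full_block hF3 hm hS hA hB hC i
    have hempty : (univ : Finset (Fin N')) = ∅ := by
      rw [univ_eq_empty_iff]; rw [this]; infer_instance
    rw [hempty, sum_empty]
    positivity
  · -- rank ≥ 2: packing defect + Lemma 2.4
    set ε' : ℝ := 1 / (6 * (m : ℝ) + 6) with hε'
    have hε0 : 0 ≤ ε' := by rw [hε']; positivity
    have hε1 : ε' < 1 := by
      rw [hε', div_lt_one (by positivity)]; linarith [(Nat.cast_nonneg m : (0:ℝ) ≤ m)]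
    have h6 : (6 : ℝ) * m + 6 ≠ 0 := by positivity
    have h5 : (6 : ℝ) * m + 5 ≠ 0 := by positivity
    have h1ε : (1 : ℝ) - ε' = (6 * m + 5) / (6 * m + 6) := by
      rw [hε', eq_div_iff h6, sub_mul, one_div_mul_cancel h6]; ring
    have hexp : (2 / (1 - ε')) / 3 = ex := by
      rw [hex]
      congr 1
      rw [h1ε, div_div_eq_mul_div, div_eq_iff h5, add_mul, div_mul_cancel₀ _ h5]
      ring
    have hdef := frame_packing_defect hF3 hm hS' (fun j v => hA (κ j) v) (fun j v => hB (κ j) v)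
      (fun j v => hC (κ j) v) hne'
    have neA : ∀ j, (A (κ j)).Nonempty := fun j => (hne' j).1
    have neB : ∀ j, (B (κ j)).Nonempty := fun j => (hne' j).2.1
    have neC : ∀ j, (C (κ j)).Nonempty := fun j => (hne' j).2.2
    -- the real form of a defect
    have toReal : ∀ {X Y : Fin N' → Finset (Fin m → F)},
        (Fintype.card F + 1) * ∑ j, (X j).card * (Y j).card < 9 * (Fintype.card F ^ m - 1) →
        (∑ j, (((X j).card * (Y j).card : ℕ) : ℝ)) ≤
          (Fintype.card (Fin m → F) : ℝ) ^ (1 - 3 * ε') := by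
      intro X Y h
      rw [hcard, hε', ← Nat.cast_sum]
      exact defect_real hq hm h
    rcases hdef with h1 | h2 | h3
    · have := hS'.sum_rpow_le_card_of_packing_defect neA neB neC hε0 hε1 (toReal h1)
      rw [hexp, hcard] at this
      exact this
    · have := hS'.rotate.sum_rpow_le_card_of_packing_defect neB neC neA hε0 hε1 (toReal h2)
      rw [hexp, hcard] at this
      have hprod : ∀ j, (B (κ j)).card * (C (κ j)).card * (A (κ j)).card =
          (A (κ j)).card * (B (κ j)).card * (C (κ j)).card := fun j => by ring
      simp_rw [hprod] at this
      exact this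
    · have := hS'.rotate.rotate.sum_rpow_le_card_of_packing_defect neC neA neB hε0 hε1
        (toReal h3)
      rw [hexp, hcard] at this
      have hprod : ∀ j, (C (κ j)).card * (A (κ j)).card * (B (κ j)).card =
          (A (κ j)).card * (B (κ j)).card * (C (κ j)).card := fun j => by ring
      simp_rw [hprod] at this
      exact this


end Catalogue

end Literature.Barriers.MatrixMultiplication

end
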